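import Literature.MathematicalPhysics.QuantumFieldTheory.Balaban1983to89.B9Thm34AllFinal

/-!
# `Balaban1983to89.B9Thm34HolderLeftFinal` — [Balaban1985BackgroundPropagators] THEOREM 3.4 p. 400, THE HÖLDER MEMBERS (3.43) WITH THE DERIVATIVE
# ON THE LEFT («‖ζ∇_UG′λ‖_β», Theorem 3.3's «‖ζ∇_UGJ‖_β») FOR THE CONCRETE `G′(U′U)` AND `G(U′U)`: every bound of (3.43)-type on a LINEAR
# FUNCTIONAL of the output (a transported Hölder difference quotient (3.40)) transfers from `U` to `U′U` through the left-entry clauses of FILES 26/28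
# — FILE 34 of the Sect. B programme of cell `lit-balaban`, seat r06 gen 17; narrows GAPS G-B9-02 («(3.43)–(3.47) for the extended operators»);
# v1.1 (same gen, APPEND-ONLY): §6 the member WITH THE DERIVATIVE ON THE RIGHT («‖ζG′∇*_Uλ‖_β») for `G′(U′U)` through gen 9's left composite

statement-level skeleton of published theorems with citation tags; proofs where landed; nothing here is a claim about the Yang–Mills mass gap

CITATION HEADER (lean-in-tree rule).  B9 = T. Bałaban, *Propagators for lattice gauge theories in a background field*, Commun. Math. Phys. **99** (1985)
389–434 (journal page = PDF page + 388; held `paper:balaban1985-cmp99-background-propagators`, text layer + the ×2 renders of pp. 397, 398 re-read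
this session).  Theorem 3.4 p. 400 [PDF 12] L7–10 «There exists a positive constant a₁ such that the operators G′(U), (Q′(U)G′²(U)Q′*(U))⁻¹, R(U),
G(U) extend to configurations U′U for α₁ ≦ a₁ as analytic functions of A. The extended operators satisfy all the inequalities of Theorems 3.1–3.3
correspondingly»; p. 403 [PDF 15] l. 1–9 «Now applying Theorem 3.1 for G′(U), the bound (3.63), the representation (3.64) and Lemma 2.1 of [4] we
can prove all the statements (3.42)–(3.47) of Theorem 3.1 for the operator G′(U′U), of course with different constants, although changes are small.
We define new constants in such a way that the statements of Theorem 3.1 hold for extended operators»; p. 407 [PDF 19] «Thus Theorem 3.4 is proved,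
assuming that Theorems 3.1–3.3 hold»; Theorem 3.1 (3.43) p. 398 [PDF 10] «‖ζ∇_UG′(U)λ‖_β, ‖ζG′(U)∇*_Uλ‖_β ≦ B₀(β₀)(Lʲη)^{1−β}·(‖ζ‖_β^ξ + |ζ|)
e^{−δ₀d(y,y′)}|λ|, ξ = L^{−j}, for 0 ≦ β ≦ β₀ < 1, ζ ∈ C₀^∞(Δ̃(y)), y ∈ Λ_j, supp λ ⊂ Δ(y′)»; the Hölder norm (3.40) p. 397 [PDF 9] «‖A‖_α =
max_μ sup_{x,x′:|x−x′|≦1} |x′ − x|^{−α}|R(U(Γ_{x,x′}))A_μ(x′) − A_μ(x)|, where Γ_{x,x′} is a shortest contour connecting points x and x′»; Theorem 3.3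
p. 399 [PDF 11] «the operator G(U) (a = 1) satisfies the inequalities (3.42)–(3.47), with G′(U) replaced by G(U) and λ replaced by a function J
defined at bonds of the lattice»; (3.62)–(3.65) pp. 402–403, (3.84)–(3.86) p. 407.  [4] = [Balaban1984PropagatorsII] (2.51)–(2.55) p. 232, Lemma 2.1
p. 234.  Rows B9.Thm3.4 × B9.Thm3.1 ((3.43) cell) × B9.Thm3.3 × B9.Eq3.62 × B9.Eq3.85 (cells only; no row head changes).

WHY / WHAT IS NEW.  FILES 20–33 of this seat carry the SUP and KERNEL members (3.42)/(3.48)/(3.49)/(3.68) of Theorem 3.4 for the concrete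
perturbation `U′U`; the Hölder members were listed as not covered (GAPS G-B9-02, «a Hölder-norm majorant calculus is not in the tree» — `B9Thm34AllFinal`
HONEST SCOPE).  For the members of (3.43) WITH THE DERIVATIVE ON THE LEFT no such calculus is needed: the transported Hölder difference quotient of
(3.40) with a cut-off, `f ↦ |x′ − x|^{−β}(ζ(x′)R(U(Γ_{x,x′}))f(x′) − ζ(x)f(x))`, is an `ℝ`-LINEAR FUNCTIONAL `Φ` of the output (§3), a bound
«`‖Φ(∇_kG′(U)λ)‖ ≦ K(y,y′)|λ|` for `supp λ ⊂ Δ(y′)`» is EXACTLY a block majorant ([4] (2.51)) of the LEFT ENTRY `X·G′(U)` with the left letter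
`X = (point probe at a point of Δ(y)) ∘ (coordinate of Φ) ∘ ∇_k` (§1–§2), and FILES 26/28 already prove that EVERY left entry transfers from `G′(U)` to
`G′(U′U)` (and from `G(U)` to `G(U′U)`) with «different constants only».  Hence (3.43)'s left-derivative members for `U′U` are corollaries of the
landed clauses — this file kernel-checks that routing.

WHAT IS PROVED (theorems only: 0 `def`, 0 sorry, 0 new named facts; standard axioms).
* §1 (abstract block-majorant calculus of [4], any lattice `W`, any `B6.Geometry`): `pointProbe_apply`; **`hasMajorant_pointProbe_mul`** /
  `probe_le_of_hasMajorant_pointProbe_mul` (functional bound `|φ(Tμ)| ≦ K(y₀,y′)|μ|` ⟺ block majorant `K` of `(single w₀ ∘ φ)·T`, `y₀` the block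
  of `w₀`); **`probe_transfer`**: a left-entry transfer clause «`X·G₁ ≺ B₁P(y)E₁` ⇒ `X·G₂ ≺ B₂P(y)E₂` for all `X`, `P ≧ 0`» transfers every bound
  `|φ(D G₁ μ)| ≦ cE₁(y₀,y′)|μ|` to `|φ(D G₂ μ)| ≦ B₂(c/B₁)E₂(y₀,y′)|μ|` (any left letter `D`, any functional `φ`).
* §2 (vector-valued functions over real coordinates `b : ι`, [4] (2.51) reading of FILES 1–33): `norm_le_sum_norm_mul_of_repr_le`, `coordProbe_apply`,
  **`norm_probe_transfer`** — the same for `𝔸`-valued functionals `Φ` in norm, constant `(Σ_i‖b_i‖)M₂B₂/B₁`.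
* §3 `holderQuot340_apply` — the (3.40) difference quotient with transport and cut-off as the linear map `w • (ζ(x′) • (τ ∘ ev_{x′}) − ζ(x) • ev_x)`.
* §4 **`thm34_Gp_holderLeft_final`** — HYPOTHESES = FILE 26 `B9Thm34SectBFinal.thm34_Gp_final` VERBATIM (Theorem 3.1 (3.24)/(3.42)₁₋₃ for `G′(U)` at
  `δ₀`, [4] Lemma 2.1 and the p. 398 scale transfer for every exponent, the `A`-free (3.19)/(3.24)/(3.60) data); CONCLUSION `∃ a₁ > 0 ∃ B ≧ 0 ∀ α₁ ≦ a₁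
  ∀ A` in (3.37) (blockwise, FILE 26's premises verbatim) `∀ D Φ y p₀ β B_h c_ζ`: «`‖Φ(D G′(U)λ)‖ ≦ B_h(Lʲη)^{1−β}c_ζe^{−δ₀d(y,y′)}|λ|` for all `λ`
  supported in `Δ(y′)`» ⇒ «`‖Φ(D G′(U′U)λ)‖ ≦ B·B_h(Lʲη)^{1−β}c_ζe^{−(9δ₀/10)d(y,y′)}|λ|`», `G′(U′U) = gPrimeExtEnd G′(U) (V′(A)G′(U))` the concrete
  operator of (3.64) — with `D = conj b (diffLetter T U η⁻¹ k)` (= `∇_{U,k}`), `Φ` a (3.40) quotient of cut-off `ζ ∈ C₀^∞(Δ̃(y))`, `B_h = B₀(β₀)`,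
  `c_ζ = ‖ζ‖_β^ξ + |ζ|` the hypothesis IS the member «‖ζ∇_UG′(U)λ‖_β» of (3.43) and the conclusion the same member for `G′(U′U)` («different
  constants»: `B·B₀(β₀)`, rate `9δ₀/10`); `D = 1` gives the Hölder quotient of `ζG′(U′U)λ` itself, `D` = the Laplacian letter the one of `ζΔ_UG′(U′U)λ`.
* §5 **`thm34_all_holderLeft_final`** — HYPOTHESES = FILE 28 `B9Thm34AllFinal.thm34_all_final` VERBATIM + `0 < B₀`; CONCLUSION: the same clause for
  `G′(U′U)` at `(B, 9δ₀/10)` AND, for THE `C⁻¹(U′U), G(U′U)` of FILE 28 (their defining two-sided-inverse identities re-exported, so uniqueness of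
  inverses identifies them with FILES 28/31's operators), the clause for `G(U′U)` on the bond carrier at `(B, δ₀/6)` — Theorem 3.3's member
  «‖ζ∇_UG(U′U)J‖_β» from «‖ζ∇_UG(U)J‖_β».  ONE `a₁`, ONE `B = (Σ_i‖b_i‖)M₂B₂₈(1/B_G + 1/B₀)`.
* §6 (v1.1) `thetaL363_linear`; **`thm34_Gp_holderRight_final`** — HYPOTHESES = FILE 26 `thm34_Gp_final` VERBATIM; CONCLUSION `∃ a₁ > 0 ∃ B ≧ 0
  ∀ α₁ ≦ a₁ ∀ A` (FILE 26's premises) `∀` right letter `D` with Theorem 3.1's entry `G′(U)·D ≺ B_GLʲη e^{−δ₀d}` ((3.42)₃-type; `D = conj b (diffLetter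
  T U η⁻¹ l)`) `∀ Φ y p₀ β B_h c_ζ`: (a) «`‖Φ(G′(U)λ)‖ ≦ B_h(Lʲη)^{2−β}c_ζe^{−δ₀d}|λ|`» (the Hölder quotient of `ζG′(U)λ` itself — NOT a member of
  (3.43); in print a consequence of (3.42)₂, here an INPUT) ∧ (b) «`‖Φ(G′(U)∇_kλ)‖ ≦ B_h(Lʲη)^{1−β}c_ζe^{−δ₀d}|λ|` for every concrete `∇_k`» (the
  member «‖ζG′∇*λ‖_β» of (3.43) for `U`, p. 398 «we may always replace ∇_U by ∇*_U») ∧ (c) the same for `D` ⇒ «`‖Φ(G′(U′U)Dλ)‖ ≦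
  B·B_h(Lʲη)^{1−β}c_ζe^{−(9δ₀/10)d}|λ|`».  ROUTE: (3.65)₁ on the right letter, `G′(U′U)D = G′(U)D + (G′(U)V′(A))(G′(U′U)D)` (from FILE 26's
  two-sided inverse), times the point probe `X`: `X·G′D` is (c); `(X·G′)·V′ ≺ B₀′θ_L(1)e^{−(49δ₀/50)d}` is gen 9's LEFT COMPOSITE
  `B9Ineq363Vprime.hasMajorant_gp_vPrime` applied to the operator `X·G′(U)`, whose (3.42)₁,₃-shaped majorants are exactly (a), (b)
  (`B₀′ = M₂B_hc_ζ(Lʲη)^{1−β}/Lʲη`); `G′(U′U)D ≺ B₂₆Lʲη e^{−(9δ₀/10)d}` is FILE 26's right-entry clause; `B9Ineq366CPrime.hasMajorant_comp_decay_left1`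
  ([4] (2.52)–(2.55) + Lemma 2.1 and the p. 398 scale transfer at `1/25`); `θ_L(1) ≦ K` below a threshold by continuity at `α₁ = 0`
  (FILE 25 `exists_bound_of_continuousAt`); `B = (Σ_i‖b_i‖)M₂(1 + K·B₂₆Λ′c₁(δ₀,1/25))`, `a₁ = min(a₁⁽²⁶⁾, 1/4, ε/2)`.

HONEST SCOPE / NOT CLAIMED.  (a) As FILES 20–33: Theorems 3.1–3.3 FOR `U` are inputs («assuming that Theorems 3.1–3.3 hold», p. 407) — here the
(3.43)-type bound for `U` is the hypothesis of each clause, per functional; nothing is asserted about `G′(U)`, `G(U)` themselves.  (b) The functional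
`Φ` is ARBITRARY (`ℝ`-linear, `𝔸`-valued): the metric `|x − x′|`, the shortest contours `Γ_{x,x′}`, the transport `R(U(Γ))` and the localisation
`ζ ∈ C₀^∞(Δ̃(y))` of (3.40)/(3.43) are not modelled — they determine WHICH functionals and weights the user feeds in; the anchor `y` is free (any block
containing a point `p₀`), so the weight `e^{−δ₀d(y,y′)}` is read at the block where print localises `ζ`.  (c) Derivative and transport are those of
`U` on both sides of each implication (p. 398: «the choice of derivatives ∇_U, ∇*_U is conventional»); print's (3.43) for `U′U` has `∇_{U′U}` and
`R((U′U)(Γ))` — a functional built with the `U′U`-transport is covered as soon as its bound for `G′(U)` is supplied (it is one of the `Φ`).  (d) The member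
«‖ζG′∇*_Uλ‖_β» (derivative on the RIGHT) transfers for `G′(U′U)` (§6) only WITH THE EXTRA INPUT (a) — the Hölder quotient of `ζG′(U)λ` itself, met
through the zeroth-order part of `V′(A)` ((3.52)/(3.60)); print does not list it in (3.43) because it follows from (3.42)₂ (a Lipschitz bound
dominates a Hölder quotient at distance ≦ 1) — a derivation that needs the metric of `T_η`, not available for an abstract functional; the same member
for `G(U′U)` (left composite `G(U)V(A)` of (3.84), FILES 20/24) is NOT in this file.  NOT COVERED: the INPUT-side Hölder members (3.44)–(3.45)
(«‖λ‖_ε^{ξ′}» on the right); the `L²` members (3.46) (an `ℓ²`-block calculus is not in the tree); (3.47) for `U′U` is the sup→global transfer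
`B9Ineq347AllEntries`/`B9Ineq347GpExt`.
(e) `|λ|` = the sup of the real coordinates of `λ` over its block and `‖·‖` on `𝔸` on the functional side (constants `M₂`, `Σ_i‖b_i‖`); `a₁`, `B`
packaged existentially after the lattice is fixed (values depend on the constants only, FILE 20 (iii)); the rates `9δ₀/10`, `δ₀/6` are FILE 26/28's
admissible choice («different constants only»); no row head changes (B9.Thm3.1/3.3/3.4 stay `typed-existing`: the heads are the printed theorems at a
general background).

RELATED IN THE TREE, NOT DUPLICATED (searched 2026-08-22: `lean search 'holderLeft|pointProbe|probe_transfer' --decl` = ∅; `holderQuot` occurs only as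
`B4Lemma24TorusHolder.holderQuot_eq_KTH`, `B5DPD127HolderUniform.holderQuot_dpd_eq` — scalar one-scale quotients, other carriers): the B6-side
Hölder-in-the-output PAIR-BOUND calculus `B6BlockHolderCalculus` (p38; `ℓ²` carriers over a pseudo-metric space, differences of two rows) is NOT used
— on the B9 carriers the left-entry clauses of FILES 26/28 already quantify over every left letter, so a functional needs only the point probe of §1;
FILE 26 `thm34_Gp_final`, FILE 28 `thm34_all_final`, gen 9 `B9Ineq363Vprime.hasMajorant_gp_vPrime`/`thetaL363`, gen 10 `B9Ineq366CPrime.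
hasMajorant_comp_decay_left1`/`hasMajorant_rate_mono`, FILE 25 `B9Thm34GKernelFinal.exists_bound_of_continuousAt` USED BY NAME (generator
`lit-balaban-r06/lean/gen35.py`: signature/premise blocks extracted from the tree files by line range).
-/

noncomputable section

namespace Literature.MathematicalPhysics.QuantumFieldTheory.Balaban1983to89.B9Thm34HolderLeftFinal

open NormedSpace Complex
open Literature.MathematicalPhysics.QuantumFieldTheory.Balaban1983to89
open Literature.MathematicalPhysics.QuantumFieldTheory.Balaban1983to89.B6RandomWalk (HasMajorant BlockSupp hasMajorant_mono Triangle254 Ineq261)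
open Literature.MathematicalPhysics.QuantumFieldTheory.Balaban1983to89.B6RandomWalkHom (HasMajorantHom)
open Literature.MathematicalPhysics.QuantumFieldTheory.Balaban1983to89.B6RandomWalkKernel (HasKernelBound)
open Literature.MathematicalPhysics.QuantumFieldTheory.Balaban1983to89.B6RandomWalkSection (secExt secRes secConj)
open Literature.MathematicalPhysics.QuantumFieldTheory.Balaban1983to89.B9Thm34Ext (toB6)
open Literature.MathematicalPhysics.QuantumFieldTheory.Balaban1983to89.B9Ineq347 (ScaleTransfer)
open Literature.MathematicalPhysics.QuantumFieldTheory.Balaban1983to89.B9Eq386Neumann (pTwo deltaA)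
open Literature.MathematicalPhysics.QuantumFieldTheory.Balaban1983to89.B9Eq39Adjoint
open Literature.MathematicalPhysics.QuantumFieldTheory.Balaban1983to89.B9Eq369Small (Through)
open Literature.MathematicalPhysics.QuantumFieldTheory.Balaban1983to89.B9Eq372Locality (stBonds)
open Literature.MathematicalPhysics.QuantumFieldTheory.Balaban1983to89.B9Eq352DivForm (tauF tauB)
open Literature.MathematicalPhysics.QuantumFieldTheory.Balaban1983to89.B9Eq352DivFormLetters
open Literature.MathematicalPhysics.QuantumFieldTheory.Balaban1983to89.B9Eq352GradLetters (diffLetter)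
open Literature.MathematicalPhysics.QuantumFieldTheory.Balaban1983to89.B9Eq371GradLetters (bT bU)
open Literature.MathematicalPhysics.QuantumFieldTheory.Balaban1983to89.B9Eq372RemLetters (lapDDLetter)
open Literature.MathematicalPhysics.QuantumFieldTheory.Balaban1983to89.B9Eq382V3Letters (dPrimeLetter)
open Literature.MathematicalPhysics.QuantumFieldTheory.Balaban1983to89.B9Eq376POneLetters (conjHom gradLin divLin)
open Literature.MathematicalPhysics.QuantumFieldTheory.Balaban1983to89.B9Eq360Vprime (gPrimeExtEnd)
open Literature.MathematicalPhysics.QuantumFieldTheory.Balaban1983to89.B9Eq360VprimeLetters (vPrimeConc)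
open Literature.MathematicalPhysics.QuantumFieldTheory.Balaban1983to89.B9Thm34SectBFinal (thm34_Gp_final)
open Literature.MathematicalPhysics.QuantumFieldTheory.Balaban1983to89.B9Thm34AllFinal (thm34_all_final)
open Literature.MathematicalPhysics.QuantumFieldTheory.Balaban1983to89.B9Ineq385VG (kappa385)
open Literature.MathematicalPhysics.QuantumFieldTheory.Balaban1983to89.B9Eq360VprimeLetters (cBConc)
open Literature.MathematicalPhysics.QuantumFieldTheory.Balaban1983to89.B9Ineq363Vprime (cVConc thetaL363 thetaL363_nonneg hasMajorant_gp_vPrime)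
open Literature.MathematicalPhysics.QuantumFieldTheory.Balaban1983to89.B9Ineq366CPrime (hasMajorant_rate_mono hasMajorant_comp_decay_left1)
open Literature.MathematicalPhysics.QuantumFieldTheory.Balaban1983to89.B9Thm34GKernelFinal (exists_bound_of_continuousAt)
open Literature.MathematicalPhysics.QuantumFieldTheory.Balaban1983to89.B6RandomWalk (hasMajorant_add)

/-! ## §1  A linear functional of the output is a left letter: the point probe (abstract block-majorant calculus of [4]) -/

section Probe

variable {G : B6.Geometry} {W : Type}

/-- **The point probe** `LinearMap.single ℝ _ w₀ ∘ₗ φ`: the endomorphism `μ ↦ (w ↦ [w = w₀]·φ(μ))` of the functions on the lattice `W` that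
writes the value of the linear functional `φ` at ONE point `w₀` and `0` elsewhere — the device by which a bound on a FUNCTIONAL of `Tμ` (a
transported Hölder difference quotient (3.40) of `Tμ`) becomes a block majorant ([4] (2.51)) of the composite `(point probe)·T`, anchored at the
block of `w₀`.  Unfolding: `((single w₀ ∘ φ) μ)(w) = if w = w₀ then φ μ else 0`.
[cite: Balaban1985BackgroundPropagators, (3.40) p.397 + (3.43) p.398; Balaban1984PropagatorsII, (2.51) p.232 (device ours)] -/
theorem pointProbe_apply [DecidableEq W] (w₀ : W) (φ : (W → ℝ) →ₗ[ℝ] ℝ) (μ : W → ℝ) (w : W) :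
    ((LinearMap.single ℝ (fun _ : W => ℝ) w₀) ∘ₗ φ) μ w = if w = w₀ then φ μ else 0 := by
  simp only [LinearMap.coe_comp, Function.comp_apply, LinearMap.coe_single, Pi.single_apply]

/-- **Functional bound ⇒ block majorant of `(point probe)·T`**: if `|φ(Tμ)| ≦ K(y₀, y′)|μ|` for `μ` supported in the block of `y′`
(`y₀` = the block of `w₀`) and `K ≧ 0`, then `(single w₀ ∘ φ) * T ≺ K`. [cite: Balaban1984PropagatorsII, (2.51) p.232 (bookkeeping ours)] -/
theorem hasMajorant_pointProbe_mul [DecidableEq W] (blk : W → G.Site) (w₀ : W) (φ : (W → ℝ) →ₗ[ℝ] ℝ) (T : Module.End ℝ (W → ℝ))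
    (K : G.Site → G.Site → ℝ) (hK : ∀ a a', 0 ≤ K a a')
    (h : ∀ (y' : G.Site) (μ : W → ℝ) (B : ℝ), BlockSupp blk μ y' B → |φ (T μ)| ≤ K (blk w₀) y' * B) :
    HasMajorant blk (((LinearMap.single ℝ (fun _ : W => ℝ) w₀) ∘ₗ φ) * T) K := by
  intro y' μ B hμ w
  rw [Module.End.mul_apply, pointProbe_apply]
  split_ifs with hw
  · subst hw
    exact h y' μ B hμ
  · rw [abs_zero]
    exact mul_nonneg (hK _ _) hμ.nonneg

/-- **Block majorant of `(point probe)·T` ⇒ functional bound**: read the majorant at the point `w₀`.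
[cite: Balaban1984PropagatorsII, (2.51) p.232 (bookkeeping ours)] -/
theorem probe_le_of_hasMajorant_pointProbe_mul [DecidableEq W] (blk : W → G.Site) (w₀ : W) (φ : (W → ℝ) →ₗ[ℝ] ℝ)
    (T : Module.End ℝ (W → ℝ)) (K : G.Site → G.Site → ℝ)
    (h : HasMajorant blk (((LinearMap.single ℝ (fun _ : W => ℝ) w₀) ∘ₗ φ) * T) K)
    (y' : G.Site) (μ : W → ℝ) (B : ℝ) (hμ : BlockSupp blk μ y' B) : |φ (T μ)| ≤ K (blk w₀) y' * B := by
  have h1 := h y' μ B hμ w₀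
  rwa [Module.End.mul_apply, pointProbe_apply, if_pos rfl] at h1

/-- **THE TRANSFER OF A LEFT-ENTRY CLAUSE TO FUNCTIONALS** (the mechanism of this file).  Suppose two operators `G₁, G₂` on the functions on
`W` satisfy the LEFT-ENTRY TRANSFER «every left entry `X·G₁ ≺ B₁P(y)E₁(y,y′)` (`P ≧ 0`) gives `X·G₂ ≺ B₂P(y)E₂(y,y′)`» (the shape of the
`G′(U′U)`- and `G(U′U)`-clauses of `B9Thm34SectBFinal.thm34_Gp_final` / `B9Thm34AllFinal.thm34_all_final`, from (3.65)/(3.86)), `B₁ > 0`,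
`E₁ ≧ 0`.  Then for every left letter `D`, every linear functional `φ`, every anchor point `w₀` and every weight `c ≧ 0`: the bound
`|φ(D G₁ μ)| ≦ c·E₁(y₀,y′)|μ|` (`μ` supported in the block of `y′`, `y₀` the block of `w₀`) implies `|φ(D G₂ μ)| ≦ B₂(c/B₁)·E₂(y₀,y′)|μ|` —
apply the clause to the left letter `X = (single w₀ ∘ φ) * D` with the constant weight `P ≡ c/B₁`.
[cite: Balaban1985BackgroundPropagators, (3.43) p.398 + p.403 l.1–9 + p.407; Balaban1984PropagatorsII, (2.51) p.232 (bookkeeping ours)] -/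
theorem probe_transfer [DecidableEq W] (blk : W → G.Site) {G₁ G₂ : Module.End ℝ (W → ℝ)} {B₁ B₂ : ℝ}
    {E₁ E₂ : G.Site → G.Site → ℝ} (hB₁ : 0 < B₁) (hE₁ : ∀ a a', 0 ≤ E₁ a a')
    (hT : ∀ (X : Module.End ℝ (W → ℝ)) (P : G.Site → ℝ), (∀ y, 0 ≤ P y) →
      HasMajorant blk (X * G₁) (fun a a' => B₁ * P a * E₁ a a') → HasMajorant blk (X * G₂) (fun a a' => B₂ * P a * E₂ a a'))
    (D : Module.End ℝ (W → ℝ)) (φ : (W → ℝ) →ₗ[ℝ] ℝ) (w₀ : W) {c : ℝ} (hc : 0 ≤ c)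
    (h : ∀ (y' : G.Site) (μ : W → ℝ) (B : ℝ), BlockSupp blk μ y' B → |φ (D (G₁ μ))| ≤ c * E₁ (blk w₀) y' * B) :
    ∀ (y' : G.Site) (μ : W → ℝ) (B : ℝ), BlockSupp blk μ y' B → |φ (D (G₂ μ))| ≤ B₂ * (c / B₁) * E₂ (blk w₀) y' * B := by
  have hP : ∀ _y : G.Site, 0 ≤ c / B₁ := fun _ => div_nonneg hc hB₁.le
  have h1 : HasMajorant blk ((((LinearMap.single ℝ (fun _ : W => ℝ) w₀) ∘ₗ φ) * D) * G₁)
      (fun a a' => B₁ * (c / B₁) * E₁ a a') := by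
    refine hasMajorant_pointProbe_mul blk w₀ φ (D * G₁) _ (fun a a' => mul_nonneg (mul_nonneg hB₁.le (hP a)) (hE₁ a a')) ?_
    intro y' μ B hμ
    have e1 : B₁ * (c / B₁) = c := by field_simp
    rw [Module.End.mul_apply, e1]
    exact h y' μ B hμ
  have h2 := hT (((LinearMap.single ℝ (fun _ : W => ℝ) w₀) ∘ₗ φ) * D) (fun _ => c / B₁) hP (by rw [mul_assoc] at h1 ⊢; exact h1)
  intro y' μ B hμ
  have h3 := probe_le_of_hasMajorant_pointProbe_mul blk w₀ φ (D * G₂) _ (by rw [← mul_assoc]; exact h2) y' μ B hμ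
  rwa [Module.End.mul_apply] at h3

end Probe

/-! ## §2  Vector-valued functionals through real coordinates -/

section Coordinates

variable {E : Type*} [NormedAddCommGroup E] [NormedSpace ℝ E] {ι : Type} [Fintype ι] {S : Type}
variable (b : Module.Basis ι ℝ E)

/-- **Norm from coordinates**: `‖v‖ ≦ (Σ_i ‖b_i‖)·B` when every coordinate `|b.repr v i| ≦ B` (`v = Σ_i (b.repr v i)b_i`).
[cite: Balaban1984PropagatorsII, (2.51) p.232 (the `|λ|` over real coordinates; bookkeeping ours)] -/
theorem norm_le_sum_norm_mul_of_repr_le (v : E) (B : ℝ) (h : ∀ i, |b.repr v i| ≤ B) : ‖v‖ ≤ (∑ i, ‖b i‖) * B := by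
  have hv : v = ∑ i, b.repr v i • b i := (b.sum_repr v).symm
  calc ‖v‖ = ‖∑ i, b.repr v i • b i‖ := by rw [← hv]
    _ ≤ ∑ i, ‖b.repr v i • b i‖ := norm_sum_le _ _
    _ ≤ ∑ i, ‖b i‖ * B := Finset.sum_le_sum fun i _ => by
        rw [norm_smul, Real.norm_eq_abs, mul_comm]
        exact mul_le_mul_of_nonneg_left (h i) (norm_nonneg _)
    _ = (∑ i, ‖b i‖) * B := by rw [Finset.sum_mul]

/-- **The `i`-th real coordinate of an `E`-valued linear functional of an `E`-valued lattice function, read on the real carrier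
`S × ι → ℝ`**: `(b.coord i ∘ Φ ∘ coord⁻¹) μ = b.repr (Φ(coord⁻¹ μ)) i`. [cite: Balaban1984PropagatorsII, (2.51) p.232 (bookkeeping ours)] -/
theorem coordProbe_apply (Φ : (S → E) →ₗ[ℝ] E) (i : ι) (μ : S × ι → ℝ) :
    ((b.coord i) ∘ₗ Φ ∘ₗ (coordEquiv (S := S) b).symm.toLinearMap) μ = b.repr (Φ ((coordEquiv b).symm μ)) i := rfl

variable {G : B6.Geometry}

/-- **THE TRANSFER FOR VECTOR-VALUED FUNCTIONALS** (`E`-valued lattice functions over real coordinates `b : ι`, `|b.repr v i| ≦ M₂‖v‖`):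
under the left-entry transfer clause for `(G₁, B₁, E₁) → (G₂, B₂, E₂)` (`B₁ > 0`, `B₂ ≧ 0`, `E₁ ≧ 0`), for every left letter `D`, every
`ℝ`-linear functional `Φ` of the `E`-valued function, every anchor `p₀` and weight `c ≧ 0`: `‖Φ(coord⁻¹(D G₁ μ))‖ ≦ c·E₁(y₀,y′)|μ|` for all
block-supported `μ` implies `‖Φ(coord⁻¹(D G₂ μ))‖ ≦ (Σ_i‖b_i‖)M₂(B₂/B₁)c·E₂(y₀,y′)|μ|` — coordinatewise `probe_transfer`, then the norm from
the coordinates. [cite: Balaban1985BackgroundPropagators, (3.43) p.398 + p.403 l.1–9 + p.407; Balaban1984PropagatorsII, (2.51) p.232 (bookkeeping ours)] -/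
theorem norm_probe_transfer [DecidableEq S] [DecidableEq ι] (blk : S × ι → G.Site) {G₁ G₂ : Module.End ℝ (S × ι → ℝ)}
    {B₁ B₂ M₂ : ℝ} {E₁ E₂ : G.Site → G.Site → ℝ} (hB₁ : 0 < B₁) (hM₂ : 0 ≤ M₂) (hE₁ : ∀ a a', 0 ≤ E₁ a a')
    (hrepr : ∀ (v : E) (i : ι), |b.repr v i| ≤ M₂ * ‖v‖)
    (hT : ∀ (X : Module.End ℝ (S × ι → ℝ)) (P : G.Site → ℝ), (∀ y, 0 ≤ P y) →
      HasMajorant blk (X * G₁) (fun a a' => B₁ * P a * E₁ a a') → HasMajorant blk (X * G₂) (fun a a' => B₂ * P a * E₂ a a'))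
    (D : Module.End ℝ (S × ι → ℝ)) (Φ : (S → E) →ₗ[ℝ] E) (p₀ : S × ι) {c : ℝ} (hc : 0 ≤ c)
    (h : ∀ (y' : G.Site) (μ : S × ι → ℝ) (B : ℝ), BlockSupp blk μ y' B →
      ‖Φ ((coordEquiv b).symm (D (G₁ μ)))‖ ≤ c * E₁ (blk p₀) y' * B) :
    ∀ (y' : G.Site) (μ : S × ι → ℝ) (B : ℝ), BlockSupp blk μ y' B →
      ‖Φ ((coordEquiv b).symm (D (G₂ μ)))‖ ≤ (∑ i, ‖b i‖) * M₂ * (B₂ / B₁) * c * E₂ (blk p₀) y' * B := by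
  intro y' μ B hμ
  -- every coordinate of the functional obeys the hypothesis with the weight `M₂ c`, hence transfers
  have hi : ∀ i : ι, |((b.coord i) ∘ₗ Φ ∘ₗ (coordEquiv (S := S) b).symm.toLinearMap) (D (G₂ μ))| ≤
      B₂ * (M₂ * c / B₁) * E₂ (blk p₀) y' * B := by
    intro i
    refine probe_transfer blk hB₁ hE₁ hT D ((b.coord i) ∘ₗ Φ ∘ₗ (coordEquiv (S := S) b).symm.toLinearMap) p₀ (mul_nonneg hM₂ hc)
      (fun z ν C hν => ?_) y' μ B hμ
    rw [coordProbe_apply]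
    calc |b.repr (Φ ((coordEquiv b).symm (D (G₁ ν)))) i| ≤ M₂ * ‖Φ ((coordEquiv b).symm (D (G₁ ν)))‖ := hrepr _ _
      _ ≤ M₂ * (c * E₁ (blk p₀) z * C) := mul_le_mul_of_nonneg_left (h z ν C hν) hM₂
      _ = M₂ * c * E₁ (blk p₀) z * C := by ring
  have hn := norm_le_sum_norm_mul_of_repr_le b (Φ ((coordEquiv b).symm (D (G₂ μ)))) _ (fun i => by
    simpa only [coordProbe_apply] using hi i)
  calc ‖Φ ((coordEquiv b).symm (D (G₂ μ)))‖ ≤ (∑ i, ‖b i‖) * (B₂ * (M₂ * c / B₁) * E₂ (blk p₀) y' * B) := hn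
    _ = (∑ i, ‖b i‖) * M₂ * (B₂ / B₁) * c * E₂ (blk p₀) y' * B := by
        field_simp

end Coordinates

/-! ## §3  The transported Hölder difference quotient (3.40) with a cut-off IS a linear functional of the output -/

section HolderQuot

variable {E : Type*} [NormedAddCommGroup E] [NormedSpace ℝ E] {S : Type}

/-- **The transported Hölder difference quotient of (3.40) with a cut-off `ζ` is an `ℝ`-linear functional** (p. 397: «‖A‖_α = max_μ
sup_{x,x′:|x−x′|≦1} |x′ − x|^{−α}|R(U(Γ_{x,x′}))A_μ(x′) − A_μ(x)|, where Γ_{x,x′} is a shortest contour connecting points x and x′»; (3.43) p. 398 takes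
it of `ζ∇_UG′(U)λ`, `ζ ∈ C₀^∞(Δ̃(y))`): for one pair of points `x, x′`, one transporter `τ` (the parallel transport `R(U(Γ_{x,x′}))`, or `R((U′U)(Γ_{x,x′}))`
for the extended operators — any continuous linear map), one cut-off `ζ` and the weight `w` (`= |x′ − x|^{−α}`), the linear map
`w • (ζ(x′) • (τ ∘ ev_{x′}) − ζ(x) • ev_x) : (S → E) →ₗ[ℝ] E` evaluates to `w·(ζ(x′)τ(f(x′)) − ζ(x)f(x))`; `‖ζF‖_α` of (3.43)/(3.45) is the supremum
of the norms of these values over the admissible pairs (and the components `μ` of a bond function) — so every member of (3.43) is a family of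
bounds on LINEAR FUNCTIONALS `Φ` of the output, the form in which §4–§5 transfer them.  The metric `|x − x′|`, the contours and the
admissibility `|x − x′| ≦ 1` are NOT modelled: they enter only through WHICH functionals the user takes. [cite: Balaban1985BackgroundPropagators, (3.40) p.397 + (3.43) p.398] -/
theorem holderQuot340_apply (ζ : S → ℝ) (τ : E →L[ℝ] E) (x x' : S) (w : ℝ) (f : S → E) :
    (w • (ζ x' • ((τ : E →ₗ[ℝ] E) ∘ₗ LinearMap.proj x') - ζ x • LinearMap.proj x) : (S → E) →ₗ[ℝ] E) f =
      w • (ζ x' • τ (f x') - ζ x • f x) := by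
  simp only [LinearMap.smul_apply, LinearMap.sub_apply, LinearMap.coe_comp, Function.comp_apply, LinearMap.coe_proj, Function.eval,
    ContinuousLinearMap.coe_coe]

end HolderQuot

/-! ## §4  THEOREM 3.4, THE HÖLDER MEMBERS (3.43) WITH THE DERIVATIVE ON THE LEFT, FOR THE CONCRETE `G′(U′U)` -/

section Gp

variable {𝔸 : Type*} [NormedRing 𝔸] [NormedAlgebra ℂ 𝔸] [CompleteSpace 𝔸] {ι : Type} [Fintype ι]
variable (b : Module.Basis ι ℝ 𝔸) {S : Type} {κ : Type} [Fintype κ]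
variable (T : κ → Equiv.Perm S) (U : κ → S → 𝔸ˣ)
variable {g : B9.Geometry} [Fintype g.Site] {Rr : ℝ} {H : Prop}

set_option maxHeartbeats 800000 in
/-- **THEOREM 3.4, THE (3.43)-TYPE HÖLDER MEMBERS OF `G′(U′U)` WITH THE DERIVATIVE (ANY LEFT LETTER) ON THE LEFT** («The extended operators satisfy
all the inequalities of Theorems 3.1–3.3 correspondingly», p. 400; «we can prove all the statements (3.42)–(3.47) of Theorem 3.1 for the operator
G′(U′U), of course with different constants», p. 403 l. 1–9), for the concrete perturbation `G′(U′U) := gPrimeExtEnd G′(U) (V′(A)G′(U))` of FILE 26.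
HYPOTHESES = FILE 26 `B9Thm34SectBFinal.thm34_Gp_final` VERBATIM.  CONCLUSION: `∃ a₁ > 0 ∃ B ≧ 0 ∀ α₁ ≦ a₁ ∀ A` in (3.37) (blockwise, FILE 26's
premises verbatim) `∀` left letter `D` (`D = conj b (diffLetter T U η⁻¹ k) = ∇_{U,k}`: the member «‖ζ∇_UG′λ‖_β» of (3.43); `D = 1`: the Hölder
quotient of `ζG′λ` itself) `∀` `ℝ`-linear `𝔸`-valued functional `Φ` of the `𝔸`-valued site function (`Φ` = ONE transported
difference quotient `|x′ − x|^{−β}(ζ(x′)R(U(Γ_{x,x′}))f(x′) − ζ(x)f(x))` of (3.40) with the cut-off `ζ`, §3 `holderQuot340_apply`) `∀` anchor `y ∈ 𝔅` with a point `p₀` of its block `∀ β, B_h ≧ 0,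
c_ζ ≧ 0` (`B_h = B₀(β₀)`, `c_ζ = ‖ζ‖_β^ξ + |ζ|`): IF `‖Φ(D G′(U)λ)‖ ≦ B_h (Lʲη)^{1−β} c_ζ e^{−δ₀d(y,y′)}|λ|` for every `λ` supported in `Δ(y′)`
— (3.43) for `U` read for this functional — THEN `‖Φ(D G′(U′U)λ)‖ ≦ B·B_h (Lʲη)^{1−β} c_ζ e^{−(9δ₀/10)d(y,y′)}|λ|` — (3.43) for `U′U`, «different
constants only».  `|λ|` = the sup of the real coordinates of `λ` over its block ([4] (2.51) reading of FILES 1–33); `B = (Σ_i‖b_i‖)M₂B₂₆/B_G`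
with `B₂₆` the constant of `thm34_Gp_final`.  PROOF: `thm34_Gp_final`'s left-entry clause «`X·G′(U) ≺ B_GP(y)e^{−δ₀d}` ⇒ `X·G′(U′U) ≺
BP(y)e^{−(9δ₀/10)d}`» applied, coordinate by coordinate, to the left letter `X = (single p₀ ∘ b.coord i ∘ Φ ∘ coord⁻¹) * D` (§1–§2).  HONEST SCOPE:
the transporter and the derivative are those of `U` on both sides (p. 398: «the choice of derivatives ∇_U, ∇*_U is conventional»; for `U′U` print
has `∇_{U′U}`, `R((U′U)(Γ))` — the functional `Φ` is arbitrary, so a `U′U`-transported quotient is covered AS SOON AS its bound for `G′(U)` is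
supplied); the member «‖ζG′(U)∇*_Uλ‖_β» of (3.43) (derivative on the RIGHT) is §6 (v1.1, one extra input); (3.44)–(3.46) are NOT covered (module header).
[cite: Balaban1985BackgroundPropagators, Thm 3.4 p.400 + Thm 3.1 (3.43) p.398 + (3.40) p.397 + (3.62)–(3.65) pp.402–403 + p.403 l.1–9; Balaban1984PropagatorsII, (2.51) p.232 + Lemma 2.1 p.234] -/
theorem thm34_Gp_holderLeft_final [Fintype S] [DecidableEq S] [DecidableEq ι] [DecidableEq g.Site] [Nonempty g.Site] (blk : S → g.Site) (d : ℕ)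
    (δ₀ BG Cq a₀ d₀ M₂ : ℝ)
    (kQ : g.Site → S → 𝔸 →L[ℝ] 𝔸) (sQ : S → 𝔸 →L[ℝ] 𝔸) (cfun w : g.Site → ℝ)
    (hBG : 0 < BG) (hCq : 0 ≤ Cq) (ha₀ : 0 ≤ a₀) (hM₂ : 0 ≤ M₂) (hδ₀ : 0 < δ₀)
    -- the multiscale geometry 𝔅 (p. 393, [4] (2.1)–(2.4)) and its axioms
    (hdnn : ∀ a a' : g.Site, 0 ≤ g.dist a a') (htri : Triangle254 (toB6 g Rr H)) (hrefl : ∀ y : g.Site, g.dist y y = 0)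
    (hsym : ∀ y y' : g.Site, g.dist y y' = g.dist y' y) (hlen : ∀ y : g.Site, 0 < g.len y) (hlenη : ∀ y : g.Site, g.eta ≤ g.len y)
    (hη : 0 < g.eta)
    -- [4] Lemma 2.1 (2.61) at the rate `δ₀`, «for every 0 < α < 1», and the p. 398 scale transfer for every exponent
    (h261 : ∀ α : ℝ, 0 < α → α < 1 → Ineq261 d (toB6 g Rr H) δ₀ α)
    (hST : ∀ α : ℝ, 0 < α → ∃ Λ : ℝ, 1 ≤ Λ ∧ ScaleTransfer g δ₀ α Λ (fun a => g.len a) ∧ ScaleTransfer g δ₀ α Λ (fun a => g.len a ^ 2) ∧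
      ScaleTransfer g δ₀ α Λ (fun a => (g.len a)⁻¹) ∧ ScaleTransfer g δ₀ α Λ (fun a => (g.len a ^ 2)⁻¹) ∧
      ScaleTransfer g δ₀ α Λ (fun a => (g.len a ^ 4)⁻¹) ∧ ScaleTransfer g δ₀ α Λ (fun y => g.len y ^ (-(4 : ℝ))))
    (hrepr : ∀ (v : 𝔸) (i : ι), |b.repr v i| ≤ M₂ * ‖v‖)
    (hU1 : ∀ m z, ‖((U m z : 𝔸ˣ) : 𝔸)‖ ≤ 1 ∧ ‖(((U m z)⁻¹ : 𝔸ˣ) : 𝔸)‖ ≤ 1)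
    (hd₀B : ∀ μ x, g.dist (blk x) (blk ((T μ).symm x)) ≤ d₀) (hd₀F : ∀ μ x, g.dist (blk x) (blk (T μ x)) ≤ d₀)
    (hd₀0 : ∀ y : g.Site, g.dist y y ≤ d₀)
    -- the `A`-independent data of the concrete `V′(A)` of (3.60)
    (hw : ∀ y, 0 ≤ w y) (hcard : ∀ y, ((B9Eq360Vprime.block blk y).card : ℝ) * w y ≤ 1)
    (hkQ : ∀ y x, blk x = y → ‖kQ y x‖ ≤ w y) (hsQ : ∀ x, ‖sQ x‖ ≤ 1) (hcfun : ∀ y, |cfun y| ≤ a₀ * (g.len y ^ 2)⁻¹)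
    -- THEOREM 3.1 for `G′(U)`: (3.24) `G′(U) = (Δ′_a(U))⁻¹` for the letter `Δ′_a(U)`, and (3.42)₁,₂,₃ at the rate `δ₀`
    {Δp Gp : Module.End ℝ (S × ι → ℝ)} (hΔpGp : Δp * Gp = 1) (hGpΔp : Gp * Δp = 1)
    (h342_1 : HasMajorant (g := toB6 g Rr H) (fun p : S × ι => blk p.1) Gp
      (fun a a' => BG * g.len a ^ 2 * Real.exp (-(δ₀ * g.dist a a'))))
    (h342_2 : ∀ k : κ ⊕ κ, HasMajorant (g := toB6 g Rr H) (fun p : S × ι => blk p.1)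
      (conj b (diffLetter T U ((g.eta : ℂ)⁻¹) k) * Gp) (fun a a' => BG * g.len a * Real.exp (-(δ₀ * g.dist a a'))))
    (h342_3 : ∀ k : κ ⊕ κ, HasMajorant (g := toB6 g Rr H) (fun p : S × ι => blk p.1)
      (Gp * conj b (diffLetter T U ((g.eta : ℂ)⁻¹) k)) (fun a a' => BG * g.len a * Real.exp (-(δ₀ * g.dist a a')))) :
    ∃ a₁ : ℝ, 0 < a₁ ∧ ∃ B : ℝ, 0 ≤ B ∧
    ∀ (α₁ : ℝ), 0 ≤ α₁ → α₁ ≤ a₁ →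
    -- the exponent field `A` in the domain (3.37), read blockwise, and the `A`-dependent (3.59) data `kF`, `sF`
    ∀ (A : κ → S → 𝔸) (kF : g.Site → S → 𝔸 →L[ℝ] 𝔸) (sF : S → 𝔸 →L[ℝ] 𝔸),
      (∀ y x, blk x = y → ‖kF y x‖ ≤ Cq * α₁ * w y) → (∀ x, ‖sF x‖ ≤ Cq * α₁) →
      (∀ ν k x, ‖((g.eta : ℂ)⁻¹) • covDstar T U ν (A k) x‖ ≤ α₁ * (g.len (blk x) ^ 2)⁻¹) →
      (∀ μ ν x, ‖((g.eta : ℂ)⁻¹) • covD T U μ (A ν) x‖ ≤ α₁ * (g.len (blk x) ^ 2)⁻¹) →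
      (∀ μ x, ‖((g.eta : ℂ)⁻¹) • covDstar T U μ (tauB T U μ (A μ)) x‖ ≤ α₁ * (g.len (blk x) ^ 2)⁻¹) →
      (∀ k x, ‖A k x‖ ≤ α₁ * (g.len (blk x))⁻¹) → (∀ ν k x, ‖tauB T U ν (A k) x‖ ≤ α₁ * (g.len (blk x))⁻¹) →
      -- NEW: the (3.43)-type Hölder members, derivative (any left letter `D`) on the left, functional `Φ` of the output, anchor `y ∋ p₀`
      ∀ (D : Module.End ℝ (S × ι → ℝ)) (Φ : (S → 𝔸) →ₗ[ℝ] 𝔸) (y : g.Site) (p₀ : S × ι), blk p₀.1 = y →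
      ∀ (β Bh cζ : ℝ), 0 ≤ Bh → 0 ≤ cζ →
        (∀ (y' : g.Site) (μ : S × ι → ℝ) (M : ℝ), BlockSupp (g := toB6 g Rr H) (fun p : S × ι => blk p.1) μ y' M →
          ‖Φ ((coordEquiv b).symm (D (Gp μ)))‖ ≤ Bh * g.len y ^ (1 - β) * cζ * Real.exp (-(δ₀ * g.dist y y')) * M) →
        ∀ (y' : g.Site) (μ : S × ι → ℝ) (M : ℝ), BlockSupp (g := toB6 g Rr H) (fun p : S × ι => blk p.1) μ y' M →
          ‖Φ ((coordEquiv b).symm (D ((gPrimeExtEnd Gp (conj b (vPrimeConc T U g.eta A blk kQ kF sQ sF cfun) * Gp)) μ)))‖ ≤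
            B * Bh * g.len y ^ (1 - β) * cζ * Real.exp (-(9 / 10 * δ₀ * g.dist y y')) * M := by
  classical
  obtain ⟨a₁, ha₁, B', hB', HA⟩ := thm34_Gp_final (Rr := Rr) (H := H) b T U blk d δ₀ BG Cq a₀ d₀ M₂ kQ sQ cfun w hBG hCq ha₀ hM₂ hδ₀ hdnn
    htri hrefl hsym hlen hlenη hη h261 hST hrepr hU1 hd₀B hd₀F hd₀0 hw hcard hkQ hsQ hcfun hΔpGp hGpΔp h342_1 h342_2 h342_3
  have hSb : 0 ≤ ∑ i, ‖b i‖ := Finset.sum_nonneg fun i _ => norm_nonneg _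
  refine ⟨a₁, ha₁, (∑ i, ‖b i‖) * M₂ * (B' / BG), mul_nonneg (mul_nonneg hSb hM₂) (div_nonneg hB' hBG.le), ?_⟩
  intro α₁ hα₁0 hα₁1 A kF sF hkF hsF h337B h337F h337Bτ hA hAτB D Φ y p₀ hp₀ β Bh cζ hBh hcζ hhyp y' μ M hμ
  obtain ⟨-, -, hGpL, -⟩ := HA α₁ hα₁0 hα₁1 A kF sF hkF hsF h337B h337F h337Bτ hA hAτB
  have hc : 0 ≤ Bh * g.len y ^ (1 - β) * cζ := mul_nonneg (mul_nonneg hBh (Real.rpow_nonneg (hlen y).le _)) hcζ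
  have key := norm_probe_transfer b (G := toB6 g Rr H) (fun p : S × ι => blk p.1) (G₁ := Gp) (G₂ := (gPrimeExtEnd Gp (conj b (vPrimeConc T U g.eta A blk kQ kF sQ sF cfun) * Gp)))
    (E₁ := fun a a' => Real.exp (-(δ₀ * g.dist a a'))) (E₂ := fun a a' => Real.exp (-(9 / 10 * δ₀ * g.dist a a')))
    hBG hM₂ (fun a a' => Real.exp_nonneg _) hrepr hGpL D Φ p₀ hc (fun z ν C hν => by
      have h1 := hhyp z ν C hν
      rw [show g.dist y z = g.dist (blk p₀.1) z by rw [hp₀]] at h1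
      simpa only [mul_assoc] using h1) y' μ M hμ
  rw [hp₀] at key
  calc ‖Φ ((coordEquiv b).symm (D ((gPrimeExtEnd Gp (conj b (vPrimeConc T U g.eta A blk kQ kF sQ sF cfun) * Gp)) μ)))‖
      ≤ (∑ i, ‖b i‖) * M₂ * (B' / BG) * (Bh * g.len y ^ (1 - β) * cζ) * Real.exp (-(9 / 10 * δ₀ * g.dist y y')) * M := key
    _ = (∑ i, ‖b i‖) * M₂ * (B' / BG) * Bh * g.len y ^ (1 - β) * cζ * Real.exp (-(9 / 10 * δ₀ * g.dist y y')) * M := by ring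

end Gp


/-! ## §5  THEOREM 3.4, THE HÖLDER MEMBERS WITH THE DERIVATIVE ON THE LEFT FOR `G′(U′U)` AND FOR `G(U′U)` TOGETHER (on FILE 28) -/

section All

variable {𝔸 : Type*} [NormedRing 𝔸] [NormedAlgebra ℂ 𝔸] [CompleteSpace 𝔸] {ι : Type} [Fintype ι]
variable (b : Module.Basis ι ℝ 𝔸) {S : Type} {κ : Type} [Fintype κ] [LinearOrder κ]
variable (T : κ → Equiv.Perm S) (U : κ → S → 𝔸ˣ)
variable {g : B9.Geometry} [Fintype g.Site] {Rr : ℝ} {H : Prop}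

set_option maxHeartbeats 1600000 in
/-- **THEOREM 3.4, THE (3.43)-TYPE HÖLDER MEMBERS WITH THE DERIVATIVE ON THE LEFT, FOR `G′(U′U)` AND FOR THE `G(U′U)` OF FILE 28 TOGETHER**
(«The extended operators satisfy all the inequalities of Theorems 3.1–3.3 correspondingly», p. 400; Theorem 3.3 p. 399: «the operator G(U)
(a = 1) satisfies the inequalities (3.42)–(3.47), with G′(U) replaced by G(U) and λ replaced by a function J defined at bonds of the lattice»; p. 407 «Thus Theorem 3.4 is proved, assuming that Theorems 3.1–3.3 hold»).  HYPOTHESES = FILE 28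
`B9Thm34AllFinal.thm34_all_final` VERBATIM plus `0 < B₀` (Theorem 3.1/3.3's `B₀` is a «positive constant», p. 397).  CONCLUSION: `∃ a₁ > 0 ∃ B ≧ 0
∀ α₁ ≦ a₁ ∀ A …` (FILE 28's premises verbatim): (i) `G′(U′U)` is the two-sided inverse of `Δ′_a(U) − V′(A)` (re-exported, identifies the operator) and
THE HÖLDER-LEFT TRANSFER of §4 for it at `(B, 9δ₀/10)`; `∃ C⁻¹(U′U), G(U′U)` — THE SAME PAIR AS FILE 28's (re-exported defining identities: `C⁻¹(U′U)` the
two-sided inverse of `Q′(U′U)G′²(U′U)Q′*(U′U)`, `G(U′U)` the two-sided inverse of the concrete `Δ_a(U′U)` built with this `C⁻¹(U′U)`; uniqueness of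
two-sided inverses identifies them with FILE 28's / FILE 31's) — with THE HÖLDER-LEFT TRANSFER for `G(U′U)` on the bond carrier at `(B, δ₀/6)`: for every
left letter `D` (`D = conj b (diffLetter (bT T) (bU U) η⁻¹ k) = ∇_{U,k}` on bond functions: Theorem 3.3's member «‖ζ∇_UGJ‖_β»), every `ℝ`-linear
`𝔸`-valued functional `Φ` of the `𝔸`-valued bond function (a transported Hölder quotient of (3.40), §3), every anchor `y ∋ p₀`, `β`, `B_h, c_ζ ≧ 0`:
`‖Φ(D G(U)J)‖ ≦ B_h(Lʲη)^{1−β}c_ζe^{−δ₀d(y,y′)}|J|` (all `J` supported in `Δ(y′)`) ⇒ `‖Φ(D G(U′U)J)‖ ≦ B·B_h(Lʲη)^{1−β}c_ζe^{−(δ₀/6)d(y,y′)}|J|`.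
`B = (Σ_i‖b_i‖)M₂B₂₈(1/B_G + 1/B₀)`.  PROOF: FILE 28's two left-entry clauses through `norm_probe_transfer` (§2).  HONEST SCOPE as §4 and the
module header: derivative/transport of `U` on both sides; right-derivative Hölder members, (3.44)–(3.46) not covered; no row head changes.
[cite: Balaban1985BackgroundPropagators, Thm 3.4 p.400 + Thm 3.1 (3.43) p.398 + Thm 3.3 p.399 + (3.40) p.397 + (3.62)–(3.65) pp.402–403 + (3.84)–(3.86) p.407; Balaban1984PropagatorsII, (2.51) p.232 + Lemma 2.1 p.234] -/
theorem thm34_all_holderLeft_final [Fintype S] [DecidableEq S] [DecidableEq ι] [DecidableEq g.Site] [Nonempty g.Site] (blk : S → g.Site) (d : ℕ)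
    (δ₀ B₀ κQ BG B₁ cF Cq a₀ C₀ d₀ M₂ κQb cFb abar : ℝ)
    (kQ : g.Site → S → 𝔸 →L[ℝ] 𝔸) (sQ : S → 𝔸 →L[ℝ] 𝔸) (cfun w : g.Site → ℝ)
    (hB₀ : 0 ≤ B₀) (hκQ : 0 < κQ) (hBG : 0 < BG) (hB₁ : 0 < B₁) (hcF : 0 < cF) (hCq : 0 ≤ Cq) (ha₀ : 0 ≤ a₀) (hC₀ : 0 ≤ C₀)
    (hM₂ : 0 ≤ M₂) (hδ₀ : 0 < δ₀) (hκQb : 0 ≤ κQb) (hcFb : 0 ≤ cFb) (habar : 0 ≤ abar)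
    -- the multiscale geometry 𝔅 (p. 393, [4] (2.1)–(2.4)) and its axioms
    (hdnn : ∀ a a' : g.Site, 0 ≤ g.dist a a') (htri : Triangle254 (toB6 g Rr H)) (hrefl : ∀ y : g.Site, g.dist y y = 0)
    (hsym : ∀ y y' : g.Site, g.dist y y' = g.dist y' y) (hlen : ∀ y : g.Site, 0 < g.len y) (hlenη : ∀ y : g.Site, g.eta ≤ g.len y)
    (hη : 0 < g.eta) (hL : 1 ≤ g.L)
    -- [4] Lemma 2.1 (2.61) at the rate `δ₀`, «for every 0 < α < 1»
    (h261 : ∀ α : ℝ, 0 < α → α < 1 → Ineq261 d (toB6 g Rr H) δ₀ α)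
    -- p. 398: «Using Lemma 2.1 in [4] we may replace the factor (Lʲη)^α by (Lʲη)^β(L^{j′}η)^γ with β + γ = α» — for every exponent, one
    -- constant `Λ(α) ≧ 1` for the six weights `(Lʲη)^{1,2,−1,−2,−4}` (natural and real powers)
    (hST : ∀ α : ℝ, 0 < α → ∃ Λ : ℝ, 1 ≤ Λ ∧ ScaleTransfer g δ₀ α Λ (fun a => g.len a) ∧ ScaleTransfer g δ₀ α Λ (fun a => g.len a ^ 2) ∧
      ScaleTransfer g δ₀ α Λ (fun a => (g.len a)⁻¹) ∧ ScaleTransfer g δ₀ α Λ (fun a => (g.len a ^ 2)⁻¹) ∧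
      ScaleTransfer g δ₀ α Λ (fun a => (g.len a ^ 4)⁻¹) ∧ ScaleTransfer g δ₀ α Λ (fun y => g.len y ^ (-(4 : ℝ))))
    -- real coordinates of `𝔸`, commuting translations, unitary-type background
    (hrepr : ∀ (v : 𝔸) (i : ι), |b.repr v i| ≤ M₂ * ‖v‖) (hT : ∀ (μ ν : κ) (x : S), T μ (T ν x) = T ν (T μ x))
    (hU1 : ∀ m z, ‖((U m z : 𝔸ˣ) : 𝔸)‖ ≤ 1 ∧ ‖(((U m z)⁻¹ : 𝔸ˣ) : 𝔸)‖ ≤ 1)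
    -- (3.35) on the plaquettes through each bond, at that bond's block scale; stencil geometry at range `d₀`
    (h35 : ∀ μ x m n y, Through T μ x m n y → ‖(plaqU T U m n y : 𝔸) - 1‖ ≤ C₀ * ((g.L ^ g.scale (blk x))⁻¹) ^ 2)
    (hd₀B : ∀ μ x, g.dist (blk x) (blk ((T μ).symm x)) ≤ d₀) (hd₀F : ∀ μ x, g.dist (blk x) (blk (T μ x)) ≤ d₀)
    (hd₀FB : ∀ μ ν x, g.dist (blk x) (blk ((T ν).symm (T μ x))) ≤ d₀)
    (hd₀st : ∀ μ x (q : κ × S), q ∈ stBonds T μ x → g.dist (blk x) (blk q.2) ≤ d₀)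
    (hd₀loc : ∀ μ x (q : κ × S), q ∈ B9Eq375Locality.locBondsA' T μ x → g.dist (blk x) (blk q.2) ≤ d₀)
    (hd₀0 : ∀ y : g.Site, g.dist y y ≤ d₀)
    -- the `A`-independent data of the concrete `V′(A)` of (3.60): (3.19) kernels/multipliers and the `a`-weights of (3.24)
    (hw : ∀ y, 0 ≤ w y) (hcard : ∀ y, ((B9Eq360Vprime.block blk y).card : ℝ) * w y ≤ 1)
    (hkQ : ∀ y x, blk x = y → ‖kQ y x‖ ≤ w y) (hsQ : ∀ x, ‖sQ x‖ ≤ 1) (hcfun : ∀ y, |cfun y| ≤ a₀ * (g.len y ^ 2)⁻¹)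
    -- THEOREM 3.1 for `G′(U)`: (3.42)₁,₂,₃ at the rate `δ₀`
    {Gp : Module.End ℝ (S × ι → ℝ)}
    (h342_1 : HasMajorant (g := toB6 g Rr H) (fun p : S × ι => blk p.1) Gp
      (fun a a' => BG * g.len a ^ 2 * Real.exp (-(δ₀ * g.dist a a'))))
    (h342_2 : ∀ k : κ ⊕ κ, HasMajorant (g := toB6 g Rr H) (fun p : S × ι => blk p.1)
      (conj b (diffLetter T U ((g.eta : ℂ)⁻¹) k) * Gp) (fun a a' => BG * g.len a * Real.exp (-(δ₀ * g.dist a a'))))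
    (h342_3 : ∀ k : κ ⊕ κ, HasMajorant (g := toB6 g Rr H) (fun p : S × ι => blk p.1)
      (Gp * conj b (diffLetter T U ((g.eta : ℂ)⁻¹) k)) (fun a a' => BG * g.len a * Real.exp (-(δ₀ * g.dist a a'))))
    -- (3.24): `G′(U) = (Δ′_a(U))⁻¹` for the letter `Δ′_a(U)`
    {Δp : Module.End ℝ (S × ι → ℝ)} (hΔpGp : Δp * Gp = 1) (hGpΔp : Gp * Δp = 1)
    -- the (3.19) letters `Q′(U)`, `Q′*(U)` in their own typing with block-local two-space majorants, a section of the block map (FILE 17)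
    (rep : g.Site → S × ι) (hrep : ∀ y : g.Site, blk (rep y).1 = y)
    {Qc : (S × ι → ℝ) →ₗ[ℝ] (g.Site → ℝ)} {Qcs : (g.Site → ℝ) →ₗ[ℝ] (S × ι → ℝ)} {Linv : Module.End ℝ (g.Site → ℝ)}
    (hQc : HasMajorantHom (g := toB6 g Rr H) (fun p : S × ι => blk p.1) (fun y : g.Site => y) Qc
      (fun a a' : g.Site => κQ * (if a = a' then (1 : ℝ) else 0)))
    (hQcs : HasMajorantHom (g := toB6 g Rr H) (fun y : g.Site => y) (fun p : S × ι => blk p.1) Qcs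
      (fun a a' : g.Site => κQ * (if a = a' then (1 : ℝ) else 0)))
    -- THEOREM 3.2 for `U`: (3.21) `C⁻¹ = (Q′G′²Q′*)⁻¹` exists (`hLinv`) with the KERNEL bound (3.48) at the rate `δ₀`
    (hLinv : (Qc ∘ₗ (Gp * Gp) ∘ₗ Qcs) * Linv = 1)
    (h348 : ∀ y y' : g.Site, |B9Thm34Inv.ker (B9Thm34Inv.vol g d) Linv y y'| ≤
      B₁ * g.len y ^ (-(4 : ℝ)) * g.len y' ^ (-(d : ℝ)) * Real.exp (-(δ₀ * g.dist y y')))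
    -- the (3.15) bond letters `Q(U)`, `Q*(U)` and the weight letter `a` of (3.24)/(3.26), with their majorants
    {G Qs Q a : Module.End ℝ ((κ × S) × ι → ℝ)}
    (hQb : HasMajorant (g := toB6 g Rr H) (fun q : (κ × S) × ι => blk q.1.2) Q (fun a a' => κQb * Real.exp (-(δ₀ * g.dist a a'))))
    (hQsb : HasMajorant (g := toB6 g Rr H) (fun q : (κ × S) × ι => blk q.1.2) Qs (fun a a' => κQb * Real.exp (-(δ₀ * g.dist a a'))))
    (ha324 : HasMajorant (g := toB6 g Rr H) (fun q : (κ × S) × ι => blk q.1.2) a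
      (fun a a' : g.Site => if a = a' then abar * (g.len a ^ 2)⁻¹ else 0))
    -- THEOREM 3.3 for `G(U)`: two-sided inverse of the concrete `Δ_a(U)` and its (3.42)-entries at the rate `δ₀`
    (hΔG : deltaA (conj b (lapDDLetter T ((g.eta : ℂ)⁻¹) U)) (conj b (dPrimeLetter T U g.eta))
      (conjHom b (gradLin T ((g.eta : ℂ)⁻¹) U) ∘ₗ (1 - (Gp ∘ₗ Qcs ∘ₗ Linv ∘ₗ Qc ∘ₗ Gp)) ∘ₗ conjHom b (divLin T ((g.eta : ℂ)⁻¹) U)) Qs a Q * G = 1)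
    (hGΔ : G * deltaA (conj b (lapDDLetter T ((g.eta : ℂ)⁻¹) U)) (conj b (dPrimeLetter T U g.eta))
      (conjHom b (gradLin T ((g.eta : ℂ)⁻¹) U) ∘ₗ (1 - (Gp ∘ₗ Qcs ∘ₗ Linv ∘ₗ Qc ∘ₗ Gp)) ∘ₗ conjHom b (divLin T ((g.eta : ℂ)⁻¹) U)) Qs a Q = 1)
    (hG : HasMajorant (g := toB6 g Rr H) (fun q : (κ × S) × ι => blk q.1.2) G
      (fun a a' => B₀ * g.len a ^ 2 * Real.exp (-(δ₀ * g.dist a a'))))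
    (hDG : ∀ k : κ ⊕ κ, HasMajorant (g := toB6 g Rr H) (fun q : (κ × S) × ι => blk q.1.2)
      (conj b (diffLetter (bT T) (bU U) ((g.eta : ℂ)⁻¹) k) * G) (fun a a' => B₀ * g.len a * Real.exp (-(δ₀ * g.dist a a'))))
    (hGD : ∀ k : κ ⊕ κ, HasMajorant (g := toB6 g Rr H) (fun q : (κ × S) × ι => blk q.1.2)
      (G * conj b (diffLetter (bT T) (bU U) ((g.eta : ℂ)⁻¹) k)) (fun a a' => B₀ * g.len a * Real.exp (-(δ₀ * g.dist a a'))))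
    -- NEW (kernel form): Theorem 3.3's (3.42)₁,₂,₃,₄ for `G(U)` as PRINTED KERNEL BOUNDS (pairing weight `c = η^d`, volume weight `v(y′) = (L^j′ η)^d`)
    {v : g.Site → ℝ} (hv : ∀ y, 0 < v y) {c : ℝ} (hc : 0 < c)
    (hGk : HasKernelBound (g := toB6 g Rr H) (fun q : (κ × S) × ι => blk q.1.2) v c G
      (fun a a' => B₀ * g.len a ^ 2 * Real.exp (-(δ₀ * g.dist a a'))))
    (hDGk : ∀ k : κ ⊕ κ, HasKernelBound (g := toB6 g Rr H) (fun q : (κ × S) × ι => blk q.1.2) v c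
      (conj b (diffLetter (bT T) (bU U) ((g.eta : ℂ)⁻¹) k) * G) (fun a a' => B₀ * g.len a * Real.exp (-(δ₀ * g.dist a a'))))
    (hGDk : ∀ l : κ ⊕ κ, HasKernelBound (g := toB6 g Rr H) (fun q : (κ × S) × ι => blk q.1.2) v c
      (G * conj b (diffLetter (bT T) (bU U) ((g.eta : ℂ)⁻¹) l)) (fun a a' => B₀ * g.len a * Real.exp (-(δ₀ * g.dist a a'))))
    (hDGDk : ∀ k l : κ ⊕ κ, HasKernelBound (g := toB6 g Rr H) (fun q : (κ × S) × ι => blk q.1.2) v c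
      (conj b (diffLetter (bT T) (bU U) ((g.eta : ℂ)⁻¹) k) * G * conj b (diffLetter (bT T) (bU U) ((g.eta : ℂ)⁻¹) l)) (fun a a' => B₀ * Real.exp (-(δ₀ * g.dist a a'))))
    -- NEW: Theorem 3.1/3.3's `B₀` is positive (p. 397 «positive constants M₁, δ₀, a₀, B₀»)
    (hB₀' : 0 < B₀) :
    ∃ a₁ : ℝ, 0 < a₁ ∧ ∃ B : ℝ, 0 ≤ B ∧
    ∀ (α₁ : ℝ), 0 ≤ α₁ → α₁ ≤ a₁ →
    -- the exponent field `A` in the domain (3.37), read blockwise in the shapes of FILES 1–19, and the `A`-dependent (3.59) data `kF`, `sF`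
    ∀ (A : κ → S → 𝔸) (kF : g.Site → S → 𝔸 →L[ℝ] 𝔸) (sF : S → 𝔸 →L[ℝ] 𝔸),
      (∀ y x, blk x = y → ‖kF y x‖ ≤ Cq * α₁ * w y) → (∀ x, ‖sF x‖ ≤ Cq * α₁) →
      (∀ ν k x, ‖((g.eta : ℂ)⁻¹) • covDstar T U ν (A k) x‖ ≤ α₁ * (g.len (blk x) ^ 2)⁻¹) →
      (∀ μ ν x, ‖((g.eta : ℂ)⁻¹) • covD T U μ (A ν) x‖ ≤ α₁ * (g.len (blk x) ^ 2)⁻¹) →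
      (∀ μ ν x, ‖((g.eta : ℂ)⁻¹) • covDstar T U ν (A ν) (T μ x)‖ ≤ α₁ * (g.len (blk x) ^ 2)⁻¹) →
      (∀ μ x, ‖((g.eta : ℂ)⁻¹) • covDstar T U μ (tauB T U μ (A μ)) x‖ ≤ α₁ * (g.len (blk x) ^ 2)⁻¹) →
      (∀ μ ν k x, ‖((g.eta : ℂ)⁻¹) • covD T U μ (A k) ((T ν).symm x)‖ ≤ α₁ * (g.len (blk x) ^ 2)⁻¹) →
      (∀ k x, ‖A k x‖ ≤ α₁ * (g.len (blk x))⁻¹) → (∀ ν k x, ‖tauB T U ν (A k) x‖ ≤ α₁ * (g.len (blk x))⁻¹) →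
      (∀ μ k x, ‖tauF T U μ (A k) x‖ ≤ α₁ * (g.len (blk x))⁻¹) →
      (∀ k μ ν x, ‖A k ((T ν).symm (T μ x))‖ ≤ α₁ * (g.len (blk x))⁻¹) →
      (∀ μ x m z, (m, z) ∈ stBonds T μ x → ‖A m z‖ ≤ α₁ * (g.len (blk x))⁻¹) →
      (∀ μ x m z, (m, z) ∈ B9Eq375Locality.locBondsA T μ x → ‖A m z‖ ≤ α₁ * (g.len (blk x))⁻¹) →
      (∀ μ x m n y, Through T μ x m n y →
        ‖covD T U m (A n) y‖ ≤ g.eta * (α₁ * ((g.len (blk x))⁻¹) ^ 2) ∧ ‖covD T U n (A m) y‖ ≤ g.eta * (α₁ * ((g.len (blk x))⁻¹) ^ 2)) →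
    -- the (3.57)/(3.59) letters `F′₂(A)`, `F′₂*(A)` (block-local, size `c_F α₁`)
    ∀ {Qc' Fc : (S × ι → ℝ) →ₗ[ℝ] (g.Site → ℝ)} {Qcs' Fcs : (g.Site → ℝ) →ₗ[ℝ] (S × ι → ℝ)},
      Qc' = Qc + Fc → Qcs' = Qcs + Fcs →
      HasMajorantHom (g := toB6 g Rr H) (fun p : S × ι => blk p.1) (fun y : g.Site => y) Fc
        (fun a a' : g.Site => cF * α₁ * (if a = a' then (1 : ℝ) else 0)) →
      HasMajorantHom (g := toB6 g Rr H) (fun y : g.Site => y) (fun p : S × ι => blk p.1) Fcs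
        (fun a a' : g.Site => cF * α₁ * (if a = a' then (1 : ℝ) else 0)) →
    -- the (3.80)–(3.81) letters `F₂(A)`, `F₂*(A)` («|F₂(A)|, |F₂*(A)| ≦ O(1)α₁»), `P₂(A)` of (3.82)
    ∀ {P₂ Qs' Q' F₂ F₂s : Module.End ℝ ((κ × S) × ι → ℝ)},
      Q' = Q + F₂ → Qs' = Qs + F₂s → P₂ = pTwo Qs Q F₂ F₂s a →
      HasMajorant (g := toB6 g Rr H) (fun q : (κ × S) × ι => blk q.1.2) F₂ (fun a a' => cFb * α₁ * Real.exp (-(δ₀ * g.dist a a'))) →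
      HasMajorant (g := toB6 g Rr H) (fun q : (κ × S) × ι => blk q.1.2) F₂s (fun a a' => cFb * α₁ * Real.exp (-(δ₀ * g.dist a a'))) →
      -- (i) `G′(U′U)`: the two-sided inverse of `Δ′_a(U) − V′(A)` (FILE 28, re-exported) and NEW: its Hölder-left members
      (Δp - conj b (vPrimeConc T U g.eta A blk kQ kF sQ sF cfun)) * (gPrimeExtEnd Gp (conj b (vPrimeConc T U g.eta A blk kQ kF sQ sF cfun) * Gp)) = 1 ∧
      (gPrimeExtEnd Gp (conj b (vPrimeConc T U g.eta A blk kQ kF sQ sF cfun) * Gp)) * (Δp - conj b (vPrimeConc T U g.eta A blk kQ kF sQ sF cfun)) = 1 ∧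
      (∀ (D : Module.End ℝ (S × ι → ℝ)) (Φ : (S → 𝔸) →ₗ[ℝ] 𝔸) (y : g.Site) (p₀ : S × ι), blk p₀.1 = y →
        ∀ (β Bh cζ : ℝ), 0 ≤ Bh → 0 ≤ cζ →
        (∀ (y' : g.Site) (μ : S × ι → ℝ) (M : ℝ), BlockSupp (g := toB6 g Rr H) (fun p : S × ι => blk p.1) μ y' M →
          ‖Φ ((coordEquiv b).symm (D (Gp μ)))‖ ≤ Bh * g.len y ^ (1 - β) * cζ * Real.exp (-(δ₀ * g.dist y y')) * M) →
        ∀ (y' : g.Site) (μ : S × ι → ℝ) (M : ℝ), BlockSupp (g := toB6 g Rr H) (fun p : S × ι => blk p.1) μ y' M →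
          ‖Φ ((coordEquiv b).symm (D ((gPrimeExtEnd Gp (conj b (vPrimeConc T U g.eta A blk kQ kF sQ sF cfun) * Gp)) μ)))‖ ≤
            B * Bh * g.len y ^ (1 - β) * cζ * Real.exp (-(9 / 10 * δ₀ * g.dist y y')) * M) ∧
    ∃ (Tinv : Module.End ℝ (g.Site → ℝ)) (GExt : Module.End ℝ ((κ × S) × ι → ℝ)),
      -- (ii) `C⁻¹(U′U)` = THE two-sided inverse of `Q′(U′U)G′²(U′U)Q′*(U′U)` (FILE 28, re-exported)
      Tinv * (Qc' ∘ₗ ((gPrimeExtEnd Gp (conj b (vPrimeConc T U g.eta A blk kQ kF sQ sF cfun) * Gp)) * (gPrimeExtEnd Gp (conj b (vPrimeConc T U g.eta A blk kQ kF sQ sF cfun) * Gp))) ∘ₗ Qcs') = 1 ∧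
      (Qc' ∘ₗ ((gPrimeExtEnd Gp (conj b (vPrimeConc T U g.eta A blk kQ kF sQ sF cfun) * Gp)) * (gPrimeExtEnd Gp (conj b (vPrimeConc T U g.eta A blk kQ kF sQ sF cfun) * Gp))) ∘ₗ Qcs') * Tinv = 1 ∧
      -- (iii) `G(U′U)` = THE two-sided inverse of the concrete `Δ_a(U′U)` built with this `C⁻¹(U′U)` (FILE 28, re-exported) and NEW: its Hölder-left members
      deltaA (conj b (lapDDLetter T ((g.eta : ℂ)⁻¹) (prodCfg U g.eta A)))
          (conj b (dPrimeLetter T (prodCfg U g.eta A) g.eta))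
          (conjHom b (gradLin T ((g.eta : ℂ)⁻¹) (prodCfg U g.eta A)) ∘ₗ (1 - ((Gp ∘ₗ Qcs ∘ₗ Linv ∘ₗ Qc ∘ₗ Gp) + (B9Eq360Vprime.pPrime Gp (gPrimeExtEnd Gp (conj b (vPrimeConc T U g.eta A blk kQ kF sQ sF cfun) * Gp)) (Qcs ∘ₗ secRes rep) (Qcs' ∘ₗ secRes rep) (secConj rep Linv) (secConj rep Tinv) (secExt rep ∘ₗ Qc) (secExt rep ∘ₗ Qc'))))
            ∘ₗ conjHom b (divLin T ((g.eta : ℂ)⁻¹) (prodCfg U g.eta A))) Qs' a Q' * GExt = 1 ∧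
      GExt *
      deltaA (conj b (lapDDLetter T ((g.eta : ℂ)⁻¹) (prodCfg U g.eta A)))
          (conj b (dPrimeLetter T (prodCfg U g.eta A) g.eta))
          (conjHom b (gradLin T ((g.eta : ℂ)⁻¹) (prodCfg U g.eta A)) ∘ₗ (1 - ((Gp ∘ₗ Qcs ∘ₗ Linv ∘ₗ Qc ∘ₗ Gp) + (B9Eq360Vprime.pPrime Gp (gPrimeExtEnd Gp (conj b (vPrimeConc T U g.eta A blk kQ kF sQ sF cfun) * Gp)) (Qcs ∘ₗ secRes rep) (Qcs' ∘ₗ secRes rep) (secConj rep Linv) (secConj rep Tinv) (secExt rep ∘ₗ Qc) (secExt rep ∘ₗ Qc'))))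
            ∘ₗ conjHom b (divLin T ((g.eta : ℂ)⁻¹) (prodCfg U g.eta A))) Qs' a Q' = 1 ∧
      (∀ (D : Module.End ℝ ((κ × S) × ι → ℝ)) (Φ : (κ × S → 𝔸) →ₗ[ℝ] 𝔸) (y : g.Site) (p₀ : (κ × S) × ι), blk p₀.1.2 = y →
        ∀ (β Bh cζ : ℝ), 0 ≤ Bh → 0 ≤ cζ →
        (∀ (y' : g.Site) (μ : (κ × S) × ι → ℝ) (M : ℝ), BlockSupp (g := toB6 g Rr H) (fun q : (κ × S) × ι => blk q.1.2) μ y' M →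
          ‖Φ ((coordEquiv b).symm (D (G μ)))‖ ≤ Bh * g.len y ^ (1 - β) * cζ * Real.exp (-(δ₀ * g.dist y y')) * M) →
        ∀ (y' : g.Site) (μ : (κ × S) × ι → ℝ) (M : ℝ), BlockSupp (g := toB6 g Rr H) (fun q : (κ × S) × ι => blk q.1.2) μ y' M →
          ‖Φ ((coordEquiv b).symm (D (GExt μ)))‖ ≤
            B * Bh * g.len y ^ (1 - β) * cζ * Real.exp (-(δ₀ / 6 * g.dist y y')) * M)
 := by
  classical
  obtain ⟨a₁, ha₁, B', hB', HALL⟩ := thm34_all_final (Rr := Rr) (H := H) b T U blk d δ₀ B₀ κQ BG B₁ cF Cq a₀ C₀ d₀ M₂ κQb cFb abar kQ sQ cfun w hB₀ hκQ hBG hB₁ hcF hCq ha₀ hC₀ hM₂ hδ₀ hκQb hcFb habar hdnn htri hrefl hsym hlen hlenη hη hL h261 hST hrepr hT hU1 h35 hd₀B hd₀F hd₀FB hd₀st hd₀loc hd₀0 hw hcard hkQ hsQ hcfun h342_1 h342_2 h342_3 hΔpGp hGpΔp rep hrep hQc hQcs hLinv h348 hQb hQsb ha324 hΔG hGΔ hG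 hDG hGD hv hc hGk hDGk hGDk hDGDk
  have hSb : 0 ≤ ∑ i, ‖b i‖ := Finset.sum_nonneg fun i _ => norm_nonneg _
  have hK₁ : 0 ≤ (∑ i, ‖b i‖) * M₂ * (B' / BG) := mul_nonneg (mul_nonneg hSb hM₂) (div_nonneg hB' hBG.le)
  have hK₂ : 0 ≤ (∑ i, ‖b i‖) * M₂ * (B' / B₀) := mul_nonneg (mul_nonneg hSb hM₂) (div_nonneg hB' hB₀'.le)
  refine ⟨a₁, ha₁, (∑ i, ‖b i‖) * M₂ * (B' / BG) + (∑ i, ‖b i‖) * M₂ * (B' / B₀), add_nonneg hK₁ hK₂, ?_⟩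
  intro α₁ hα₁0 hα₁1 A kF sF hkF hsF h337B h337F h337B' h337Bτ h337FB hA hAτB hAτF hAFB hAst hAloc hdAst Qc' Fc Qcs' Fcs h357
    h357s hFc hFcs P₂ Qs' Q' F₂ F₂s h380 h380s hP₂def hF₂ hF₂s
  obtain ⟨i1, i2, hGpL, -, Tinv, GExt, e1, e2, -, -, -, -, -, -, -, -, -, e3, e4, hGL, -, -, -, -, -⟩ := HALL α₁ hα₁0 hα₁1 A kF sF hkF
    hsF h337B h337F h337B' h337Bτ h337FB hA hAτB hAτF hAFB hAst hAloc hdAst h357 h357s hFc hFcs h380 h380s hP₂def hF₂ hF₂s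
  refine ⟨i1, i2, ?_, Tinv, GExt, e1, e2, e3, e4, ?_⟩
  · intro D Φ y p₀ hp₀ β Bh cζ hBh hcζ hhyp y' μ M hμ
    have hcw : 0 ≤ Bh * g.len y ^ (1 - β) * cζ := mul_nonneg (mul_nonneg hBh (Real.rpow_nonneg (hlen y).le _)) hcζ
    have key := norm_probe_transfer b (G := toB6 g Rr H) (fun p : S × ι => blk p.1) (G₁ := Gp) (G₂ := (gPrimeExtEnd Gp (conj b (vPrimeConc T U g.eta A blk kQ kF sQ sF cfun) * Gp)))
      (E₁ := fun a a' => Real.exp (-(δ₀ * g.dist a a'))) (E₂ := fun a a' => Real.exp (-(9 / 10 * δ₀ * g.dist a a')))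
      hBG hM₂ (fun a a' => Real.exp_nonneg _) hrepr hGpL D Φ p₀ hcw (fun z ν C hν => by
        have h1 := hhyp z ν C hν
        rw [show g.dist y z = g.dist (blk p₀.1) z by rw [hp₀]] at h1
        simpa only [mul_assoc] using h1) y' μ M hμ
    rw [hp₀] at key
    have hE : 0 ≤ Real.exp (-(9 / 10 * δ₀ * g.dist y y')) := Real.exp_nonneg _
    calc ‖Φ ((coordEquiv b).symm (D ((gPrimeExtEnd Gp (conj b (vPrimeConc T U g.eta A blk kQ kF sQ sF cfun) * Gp)) μ)))‖
        ≤ (∑ i, ‖b i‖) * M₂ * (B' / BG) * (Bh * g.len y ^ (1 - β) * cζ) * Real.exp (-(9 / 10 * δ₀ * g.dist y y')) * M := key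
      _ ≤ ((∑ i, ‖b i‖) * M₂ * (B' / BG) + (∑ i, ‖b i‖) * M₂ * (B' / B₀)) * (Bh * g.len y ^ (1 - β) * cζ) *
            Real.exp (-(9 / 10 * δ₀ * g.dist y y')) * M :=
          mul_le_mul_of_nonneg_right (mul_le_mul_of_nonneg_right (mul_le_mul_of_nonneg_right (le_add_of_nonneg_right hK₂) hcw) hE) hμ.nonneg
      _ = ((∑ i, ‖b i‖) * M₂ * (B' / BG) + (∑ i, ‖b i‖) * M₂ * (B' / B₀)) * Bh * g.len y ^ (1 - β) * cζ *
            Real.exp (-(9 / 10 * δ₀ * g.dist y y')) * M := by ring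
  · intro D Φ y p₀ hp₀ β Bh cζ hBh hcζ hhyp y' μ M hμ
    have hcw : 0 ≤ Bh * g.len y ^ (1 - β) * cζ := mul_nonneg (mul_nonneg hBh (Real.rpow_nonneg (hlen y).le _)) hcζ
    have key := norm_probe_transfer b (G := toB6 g Rr H) (fun q : (κ × S) × ι => blk q.1.2) (G₁ := G) (G₂ := GExt)
      (E₁ := fun a a' => Real.exp (-(δ₀ * g.dist a a'))) (E₂ := fun a a' => Real.exp (-(δ₀ / 6 * g.dist a a')))
      hB₀' hM₂ (fun a a' => Real.exp_nonneg _) hrepr hGL D Φ p₀ hcw (fun z ν C hν => by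
        have h1 := hhyp z ν C hν
        rw [show g.dist y z = g.dist (blk p₀.1.2) z by rw [hp₀]] at h1
        simpa only [mul_assoc] using h1) y' μ M hμ
    rw [hp₀] at key
    have hE : 0 ≤ Real.exp (-(δ₀ / 6 * g.dist y y')) := Real.exp_nonneg _
    calc ‖Φ ((coordEquiv b).symm (D (GExt μ)))‖
        ≤ (∑ i, ‖b i‖) * M₂ * (B' / B₀) * (Bh * g.len y ^ (1 - β) * cζ) * Real.exp (-(δ₀ / 6 * g.dist y y')) * M := key
      _ ≤ ((∑ i, ‖b i‖) * M₂ * (B' / BG) + (∑ i, ‖b i‖) * M₂ * (B' / B₀)) * (Bh * g.len y ^ (1 - β) * cζ) *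
            Real.exp (-(δ₀ / 6 * g.dist y y')) * M :=
          mul_le_mul_of_nonneg_right (mul_le_mul_of_nonneg_right (mul_le_mul_of_nonneg_right (le_add_of_nonneg_left hK₁) hcw) hE) hμ.nonneg
      _ = ((∑ i, ‖b i‖) * M₂ * (B' / BG) + (∑ i, ‖b i‖) * M₂ * (B' / B₀)) * Bh * g.len y ^ (1 - β) * cζ *
            Real.exp (-(δ₀ / 6 * g.dist y y')) * M := by ring

end All


/-! ## §6  THEOREM 3.4, THE HÖLDER MEMBER OF (3.43) WITH THE DERIVATIVE ON THE RIGHT («‖ζG′∇*_Uλ‖_β») FOR THE CONCRETE `G′(U′U)` -/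

section GpRight

variable {𝔸 : Type*} [NormedRing 𝔸] [NormedAlgebra ℂ 𝔸] [CompleteSpace 𝔸] {ι : Type} [Fintype ι]
variable (b : Module.Basis ι ℝ 𝔸) {S : Type} {κ : Type} [Fintype κ]
variable (T : κ → Equiv.Perm S) (U : κ → S → 𝔸ˣ)
variable {g : B9.Geometry} [Fintype g.Site] {Rr : ℝ} {H : Prop}

/-- `θ_L` is linear in the constant `B₀` of the `G′`-majorants it is fed: `θ_L(B₀) = B₀·θ_L(1)` (bookkeeping for §6, where the point-probe
composite `X·G′(U)` plays `G′(U)` with its own constant). [cite: Balaban1985BackgroundPropagators, (3.63) p.402 (bookkeeping ours)] -/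
theorem thetaL363_linear (d : ℕ) (ρu α₁ a₀ C M₂ Sb E₀ B₀ Λ c : ℝ) :
    thetaL363 d ρu α₁ a₀ C M₂ Sb E₀ B₀ Λ c = B₀ * thetaL363 d ρu α₁ a₀ C M₂ Sb E₀ 1 Λ c := by
  unfold thetaL363 kappa385
  ring

set_option maxHeartbeats 1600000 in
/-- **THEOREM 3.4, THE (3.43)-TYPE HÖLDER MEMBER OF `G′(U′U)` WITH THE DERIVATIVE (ANY RIGHT LETTER) ON THE RIGHT** («‖ζG′(U)∇*_Uλ‖_β ≦ B₀(β₀)(Lʲη)^{1−β}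
(‖ζ‖_β^ξ + |ζ|)e^{−δ₀d(y,y′)}|λ|», (3.43) p. 398, for `U′U`: «The extended operators satisfy all the inequalities of Theorems 3.1–3.3 correspondingly»,
p. 400).  HYPOTHESES = FILE 26 `B9Thm34SectBFinal.thm34_Gp_final` VERBATIM.  CONCLUSION: `∃ a₁ > 0 ∃ B ≧ 0 ∀ α₁ ≦ a₁ ∀ A` in (3.37) (FILE 26's
premises verbatim) `∀` right letter `D` with Theorem 3.1's entry `G′(U)·D ≺ B_G Lʲη e^{−δ₀d}` ((3.42)₃, `D = conj b (diffLetter T U η⁻¹ l) = ∇*`-type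
letter) `∀ Φ y p₀ β B_h c_ζ`: IF (a) the Hölder quotient of `ζG′(U)λ` ITSELF obeys `‖Φ(G′(U)λ)‖ ≦ B_h(Lʲη)^{2−β}c_ζe^{−δ₀d(y,y′)}|λ|` — NOT a member
of (3.43): in print it follows from (3.42)₂ (a Lipschitz bound dominates a Hölder quotient at distance ≦ 1), here an explicit hypothesis — (b) for
every concrete difference letter `∇_k` the member «‖ζG′(U)∇_kλ‖_β»: `‖Φ(G′(U)∇_kλ)‖ ≦ B_h(Lʲη)^{1−β}c_ζe^{−δ₀d(y,y′)}|λ|`, and (c) the same for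
`D`, THEN `‖Φ(G′(U′U)Dλ)‖ ≦ B·B_h(Lʲη)^{1−β}c_ζe^{−(9δ₀/10)d(y,y′)}|λ|`.  ROUTE (p. 403 l. 1–9 «applying Theorem 3.1 for G′(U), the bound (3.63), the
representation (3.64)»): the first form of (3.65) read on the right letter, `G′(U′U)D = G′(U)D + (G′(U)V′(A))(G′(U′U)D)`, multiplied on the left by
the point probe `X` (§1): `X G′(U)D` is (c); `(X G′(U))V′(A) ≺ θ_L′e^{−(49δ₀/50)d}` is gen 9's LEFT COMPOSITE `B9Ineq363Vprime.hasMajorant_gp_vPrime`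
(divergence form of the concrete `V′(A)`) applied to the operator `X·G′(U)` — whose (3.42)₁,₃-shaped majorants ARE (a), (b) — and `G′(U′U)D ≺
B₂₆Lʲη e^{−(9δ₀/10)d}` is FILE 26's right-entry clause; composition by `B9Ineq366CPrime.hasMajorant_comp_decay_left1` ([4] (2.52)–(2.55), Lemma 2.1 at
`1/25`, the p. 398 scale transfer at `1/25`); `θ_L′ ≦ B₀′K` for `α₁` below a threshold by continuity at `α₁ = 0` (FILE 25
`exists_bound_of_continuousAt`).  `B = (Σ_i‖b_i‖)M₂(1 + K·B₂₆Λ′c₁(δ₀, 1/25))`.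
[cite: Balaban1985BackgroundPropagators, Thm 3.4 p.400 + Thm 3.1 (3.42)–(3.43) pp.397–398 + (3.40) p.397 + (3.60)–(3.65) pp.402–403 + p.403 l.1–9; Balaban1984PropagatorsII, (2.51)–(2.55) p.232 + Lemma 2.1 p.234] -/
theorem thm34_Gp_holderRight_final [Fintype S] [DecidableEq S] [DecidableEq ι] [DecidableEq g.Site] [Nonempty g.Site] (blk : S → g.Site) (d : ℕ)
    (δ₀ BG Cq a₀ d₀ M₂ : ℝ)
    (kQ : g.Site → S → 𝔸 →L[ℝ] 𝔸) (sQ : S → 𝔸 →L[ℝ] 𝔸) (cfun w : g.Site → ℝ)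
    (hBG : 0 < BG) (hCq : 0 ≤ Cq) (ha₀ : 0 ≤ a₀) (hM₂ : 0 ≤ M₂) (hδ₀ : 0 < δ₀)
    -- the multiscale geometry 𝔅 (p. 393, [4] (2.1)–(2.4)) and its axioms
    (hdnn : ∀ a a' : g.Site, 0 ≤ g.dist a a') (htri : Triangle254 (toB6 g Rr H)) (hrefl : ∀ y : g.Site, g.dist y y = 0)
    (hsym : ∀ y y' : g.Site, g.dist y y' = g.dist y' y) (hlen : ∀ y : g.Site, 0 < g.len y) (hlenη : ∀ y : g.Site, g.eta ≤ g.len y)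
    (hη : 0 < g.eta)
    -- [4] Lemma 2.1 (2.61) at the rate `δ₀`, «for every 0 < α < 1», and the p. 398 scale transfer for every exponent
    (h261 : ∀ α : ℝ, 0 < α → α < 1 → Ineq261 d (toB6 g Rr H) δ₀ α)
    (hST : ∀ α : ℝ, 0 < α → ∃ Λ : ℝ, 1 ≤ Λ ∧ ScaleTransfer g δ₀ α Λ (fun a => g.len a) ∧ ScaleTransfer g δ₀ α Λ (fun a => g.len a ^ 2) ∧
      ScaleTransfer g δ₀ α Λ (fun a => (g.len a)⁻¹) ∧ ScaleTransfer g δ₀ α Λ (fun a => (g.len a ^ 2)⁻¹) ∧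
      ScaleTransfer g δ₀ α Λ (fun a => (g.len a ^ 4)⁻¹) ∧ ScaleTransfer g δ₀ α Λ (fun y => g.len y ^ (-(4 : ℝ))))
    (hrepr : ∀ (v : 𝔸) (i : ι), |b.repr v i| ≤ M₂ * ‖v‖)
    (hU1 : ∀ m z, ‖((U m z : 𝔸ˣ) : 𝔸)‖ ≤ 1 ∧ ‖(((U m z)⁻¹ : 𝔸ˣ) : 𝔸)‖ ≤ 1)
    (hd₀B : ∀ μ x, g.dist (blk x) (blk ((T μ).symm x)) ≤ d₀) (hd₀F : ∀ μ x, g.dist (blk x) (blk (T μ x)) ≤ d₀)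
    (hd₀0 : ∀ y : g.Site, g.dist y y ≤ d₀)
    -- the `A`-independent data of the concrete `V′(A)` of (3.60)
    (hw : ∀ y, 0 ≤ w y) (hcard : ∀ y, ((B9Eq360Vprime.block blk y).card : ℝ) * w y ≤ 1)
    (hkQ : ∀ y x, blk x = y → ‖kQ y x‖ ≤ w y) (hsQ : ∀ x, ‖sQ x‖ ≤ 1) (hcfun : ∀ y, |cfun y| ≤ a₀ * (g.len y ^ 2)⁻¹)
    -- THEOREM 3.1 for `G′(U)`: (3.24) `G′(U) = (Δ′_a(U))⁻¹` for the letter `Δ′_a(U)`, and (3.42)₁,₂,₃ at the rate `δ₀`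
    {Δp Gp : Module.End ℝ (S × ι → ℝ)} (hΔpGp : Δp * Gp = 1) (hGpΔp : Gp * Δp = 1)
    (h342_1 : HasMajorant (g := toB6 g Rr H) (fun p : S × ι => blk p.1) Gp
      (fun a a' => BG * g.len a ^ 2 * Real.exp (-(δ₀ * g.dist a a'))))
    (h342_2 : ∀ k : κ ⊕ κ, HasMajorant (g := toB6 g Rr H) (fun p : S × ι => blk p.1)
      (conj b (diffLetter T U ((g.eta : ℂ)⁻¹) k) * Gp) (fun a a' => BG * g.len a * Real.exp (-(δ₀ * g.dist a a'))))
    (h342_3 : ∀ k : κ ⊕ κ, HasMajorant (g := toB6 g Rr H) (fun p : S × ι => blk p.1)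
      (Gp * conj b (diffLetter T U ((g.eta : ℂ)⁻¹) k)) (fun a a' => BG * g.len a * Real.exp (-(δ₀ * g.dist a a')))) :
    ∃ a₁ : ℝ, 0 < a₁ ∧ ∃ B : ℝ, 0 ≤ B ∧
    ∀ (α₁ : ℝ), 0 ≤ α₁ → α₁ ≤ a₁ →
    -- the exponent field `A` in the domain (3.37), read blockwise, and the `A`-dependent (3.59) data `kF`, `sF`
    ∀ (A : κ → S → 𝔸) (kF : g.Site → S → 𝔸 →L[ℝ] 𝔸) (sF : S → 𝔸 →L[ℝ] 𝔸),
      (∀ y x, blk x = y → ‖kF y x‖ ≤ Cq * α₁ * w y) → (∀ x, ‖sF x‖ ≤ Cq * α₁) →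
      (∀ ν k x, ‖((g.eta : ℂ)⁻¹) • covDstar T U ν (A k) x‖ ≤ α₁ * (g.len (blk x) ^ 2)⁻¹) →
      (∀ μ ν x, ‖((g.eta : ℂ)⁻¹) • covD T U μ (A ν) x‖ ≤ α₁ * (g.len (blk x) ^ 2)⁻¹) →
      (∀ μ x, ‖((g.eta : ℂ)⁻¹) • covDstar T U μ (tauB T U μ (A μ)) x‖ ≤ α₁ * (g.len (blk x) ^ 2)⁻¹) →
      (∀ k x, ‖A k x‖ ≤ α₁ * (g.len (blk x))⁻¹) → (∀ ν k x, ‖tauB T U ν (A k) x‖ ≤ α₁ * (g.len (blk x))⁻¹) →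
      -- NEW: the (3.43)-type Hölder member with the derivative (any right letter `D` with a (3.42)₃-type entry) on the RIGHT
      ∀ (D : Module.End ℝ (S × ι → ℝ)),
        HasMajorant (g := toB6 g Rr H) (fun p : S × ι => blk p.1) (Gp * D) (fun a a' => BG * g.len a * Real.exp (-(δ₀ * g.dist a a'))) →
      ∀ (Φ : (S → 𝔸) →ₗ[ℝ] 𝔸) (y : g.Site) (p₀ : S × ι), blk p₀.1 = y →
      ∀ (β Bh cζ : ℝ), 0 ≤ Bh → 0 ≤ cζ →
        -- (a) the Hölder quotient of `ζG′(U)λ` itself (from (3.42)₂ in print; an input here)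
        (∀ (y' : g.Site) (μ : S × ι → ℝ) (M : ℝ), BlockSupp (g := toB6 g Rr H) (fun p : S × ι => blk p.1) μ y' M →
          ‖Φ ((coordEquiv b).symm (Gp μ))‖ ≤ Bh * g.len y ^ (2 - β) * cζ * Real.exp (-(δ₀ * g.dist y y')) * M) →
        -- (b) the member «‖ζG′(U)∇_kλ‖_β» for every concrete difference letter
        (∀ (k : κ ⊕ κ) (y' : g.Site) (μ : S × ι → ℝ) (M : ℝ), BlockSupp (g := toB6 g Rr H) (fun p : S × ι => blk p.1) μ y' M →
          ‖Φ ((coordEquiv b).symm ((Gp * conj b (diffLetter T U ((g.eta : ℂ)⁻¹) k)) μ))‖ ≤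
            Bh * g.len y ^ (1 - β) * cζ * Real.exp (-(δ₀ * g.dist y y')) * M) →
        -- (c) the member for the right letter `D`
        (∀ (y' : g.Site) (μ : S × ι → ℝ) (M : ℝ), BlockSupp (g := toB6 g Rr H) (fun p : S × ι => blk p.1) μ y' M →
          ‖Φ ((coordEquiv b).symm ((Gp * D) μ))‖ ≤ Bh * g.len y ^ (1 - β) * cζ * Real.exp (-(δ₀ * g.dist y y')) * M) →
        ∀ (y' : g.Site) (μ : S × ι → ℝ) (M : ℝ), BlockSupp (g := toB6 g Rr H) (fun p : S × ι => blk p.1) μ y' M →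
          ‖Φ ((coordEquiv b).symm (((gPrimeExtEnd Gp (conj b (vPrimeConc T U g.eta A blk kQ kF sQ sF cfun) * Gp)) * D) μ))‖ ≤
            B * Bh * g.len y ^ (1 - β) * cζ * Real.exp (-(9 / 10 * δ₀ * g.dist y y')) * M := by
  classical
  obtain ⟨y₀⟩ := ‹Nonempty g.Site›
  obtain ⟨a₁, ha₁, B', hB', HA⟩ := thm34_Gp_final (Rr := Rr) (H := H) b T U blk d δ₀ BG Cq a₀ d₀ M₂ kQ sQ cfun w hBG hCq ha₀ hM₂ hδ₀ hdnn
    htri hrefl hsym hlen hlenη hη h261 hST hrepr hU1 hd₀B hd₀F hd₀0 hw hcard hkQ hsQ hcfun hΔpGp hGpΔp h342_1 h342_2 h342_3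
  have hSb : 0 ≤ ∑ i, ‖b i‖ := Finset.sum_nonneg fun i _ => norm_nonneg _
  -- the p. 398 scale transfers and [4] Lemma 2.1 at the exponents `1/100` (gen 9's left composite) and `1/25` (the final composition)
  obtain ⟨Λ, hΛ, -, -, hT1i, hT2i, -, -⟩ := hST (1 / 100) (by norm_num)
  obtain ⟨Λ', hΛ'1, hT1', -, -, -, -, -⟩ := hST (1 / 25) (by norm_num)
  have hΛ0 : 0 ≤ Λ := zero_le_one.trans hΛ
  have hΛ'0 : 0 ≤ Λ' := zero_le_one.trans hΛ'1
  have h261β : Ineq261 d (toB6 g Rr H) δ₀ (1 / 100) := h261 _ (by norm_num) (by norm_num)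
  have h261' : Ineq261 d (toB6 g Rr H) δ₀ (1 / 25) := h261 _ (by norm_num) (by norm_num)
  have hc1' : 0 ≤ B6.c1 d δ₀ (1 / 25) := B6RandomWalk.c1_nonneg d δ₀ (1 / 25)
  -- «for α₁ sufficiently small»: the unit-normalised `θ_L(1)` is continuous at `α₁ = 0`, hence bounded below a threshold
  obtain ⟨K, ε, hK, hε, hKb⟩ := exists_bound_of_continuousAt
    (f := fun α₁ : ℝ => thetaL363 (Fintype.card κ) 1 α₁ a₀ Cq M₂ (∑ i, ‖b i‖) (Real.exp (δ₀ * d₀)) 1 Λ (B6.c1 d δ₀ (1 / 100)))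
    (by unfold thetaL363 kappa385 cVConc cBConc; fun_prop)
  have hBfin : 0 ≤ (∑ i, ‖b i‖) * M₂ * (1 + K * B' * Λ' * B6.c1 d δ₀ (1 / 25)) :=
    mul_nonneg (mul_nonneg hSb hM₂) (by positivity)
  refine ⟨min (min a₁ (1 / 4)) (ε / 2), lt_min (lt_min ha₁ (by norm_num)) (half_pos hε),
    (∑ i, ‖b i‖) * M₂ * (1 + K * B' * Λ' * B6.c1 d δ₀ (1 / 25)), hBfin, ?_⟩
  intro α₁ hα₁0 hα₁1 A kF sF hkF hsF h337B h337F h337Bτ hA hAτB D hGpD Φ y p₀ hp₀ β Bh cζ hBh hcζ h0 hR hD y' μ M hμ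
  have hα₁a : α₁ ≤ a₁ := hα₁1.trans ((min_le_left _ _).trans (min_le_left _ _))
  have hα₁q : α₁ ≤ 1 / 4 := hα₁1.trans ((min_le_left _ _).trans (min_le_right _ _))
  have hα₁ε : |α₁| < ε := by rw [abs_of_nonneg hα₁0]; linarith only [hα₁1, min_le_right (min a₁ (1 / 4)) (ε / 2), hε]
  obtain ⟨i1, -, -, hGpR⟩ := HA α₁ hα₁0 hα₁a A kF sF hkF hsF h337B h337F h337Bτ hA hAτB
  -- names
  set V : Module.End ℝ (S × ι → ℝ) := (conj b (vPrimeConc T U g.eta A blk kQ kF sQ sF cfun)) with hVdef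
  set E : Module.End ℝ (S × ι → ℝ) := (gPrimeExtEnd Gp (conj b (vPrimeConc T U g.eta A blk kQ kF sQ sF cfun) * Gp)) with hEdef
  -- (3.65)₁ from the two-sided inverse: `E = G′ + G′V′E`, read on the right letter `D`
  have hE : E = Gp + Gp * V * E := by
    have e1 : Gp * ((Δp - V) * E) = Gp := by rw [i1, mul_one]
    have e2 : Gp * ((Δp - V) * E) = E - Gp * V * E := by
      rw [sub_mul, mul_sub, ← mul_assoc, hGpΔp, one_mul, mul_assoc]
    rw [e2] at e1
    exact (sub_eq_iff_eq_add.mp e1)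
  have hED : E * D = Gp * D + Gp * V * (E * D) := by
    conv_lhs => rw [hE]
    rw [add_mul]
    simp only [mul_assoc]
  -- the anchor: from now on `y` is the block of `p₀`
  subst hp₀
  -- the constant of the point-probe composite and the two rescalings of the printed weights
  have hℓ : 0 < g.len (blk p₀.1) := hlen _
  set B₀' : ℝ := M₂ * (Bh * g.len (blk p₀.1) ^ (1 - β) * cζ) * (g.len (blk p₀.1))⁻¹ with hB₀'def
  have hB₀'0 : 0 ≤ B₀' := mul_nonneg (mul_nonneg hM₂ (mul_nonneg (mul_nonneg hBh (Real.rpow_nonneg hℓ.le _)) hcζ)) (inv_nonneg.mpr hℓ.le)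
  have hpow : g.len (blk p₀.1) ^ (2 - β) = g.len (blk p₀.1) ^ (1 - β) * g.len (blk p₀.1) := by
    rw [show (2 : ℝ) - β = (1 - β) + 1 by ring, Real.rpow_add hℓ, Real.rpow_one]
  have hB1 : B₀' * g.len (blk p₀.1) = M₂ * (Bh * g.len (blk p₀.1) ^ (1 - β) * cζ) := by
    rw [hB₀'def]; field_simp
  have hB2 : B₀' * g.len (blk p₀.1) ^ 2 = M₂ * (Bh * g.len (blk p₀.1) ^ (2 - β) * cζ) := by
    rw [hpow, hB₀'def]; field_simp
  -- the exponential weights are nonnegative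
  have hE₀ : ∀ a a' : g.Site, 0 ≤ Real.exp (-(δ₀ * g.dist a a')) := fun a a' => Real.exp_nonneg _
  -- per real coordinate `i` of `Φ`: the point probe `Xᵢ` and the three majorants of `Xᵢ·G′(U)`, `Xᵢ·G′(U)∇_k`, `Xᵢ·G′(U)D`
  have hcoord : ∀ i : ι,
      |((b.coord i) ∘ₗ Φ ∘ₗ (coordEquiv (S := S) b).symm.toLinearMap) ((E * D) μ)| ≤
        (B₀' * (1 + K * B' * Λ' * B6.c1 d δ₀ (1 / 25))) * g.len (blk p₀.1) * Real.exp (-(9 / 10 * δ₀ * g.dist (blk p₀.1) y')) * M := by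
    intro i
    set X : Module.End ℝ (S × ι → ℝ) :=
      (LinearMap.single ℝ (fun _ : S × ι => ℝ) p₀) ∘ₗ ((b.coord i) ∘ₗ Φ ∘ₗ (coordEquiv (S := S) b).symm.toLinearMap) with hXdef
    -- (a) ⇒ `X·G′ ≺ B₀′(Lʲη)²e^{−δ₀d}`
    have hX1 : HasMajorant (g := toB6 g Rr H) (fun p : S × ι => blk p.1) (X * Gp)
        (fun a a' => B₀' * g.len a ^ 2 * Real.exp (-(δ₀ * g.dist a a'))) := by
      refine hasMajorant_pointProbe_mul (G := toB6 g Rr H) (fun p : S × ι => blk p.1) p₀ _ Gp _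
        (fun a a' => mul_nonneg (mul_nonneg hB₀'0 (sq_nonneg _)) (hE₀ a a')) fun z ν C hν => ?_
      rw [coordProbe_apply]
      calc |b.repr (Φ ((coordEquiv b).symm (Gp ν))) i| ≤ M₂ * ‖Φ ((coordEquiv b).symm (Gp ν))‖ := hrepr _ _
        _ ≤ M₂ * (Bh * g.len (blk p₀.1) ^ (2 - β) * cζ * Real.exp (-(δ₀ * g.dist (blk p₀.1) z)) * C) :=
            mul_le_mul_of_nonneg_left (h0 z ν C hν) hM₂
        _ = B₀' * g.len (blk p₀.1) ^ 2 * Real.exp (-(δ₀ * g.dist (blk p₀.1) z)) * C := by rw [hB2]; ring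
    -- (b) ⇒ `X·G′∇_k ≺ B₀′Lʲη e^{−δ₀d}`
    have hX3 : ∀ k : κ ⊕ κ, HasMajorant (g := toB6 g Rr H) (fun p : S × ι => blk p.1) (X * Gp * conj b (diffLetter T U ((g.eta : ℂ)⁻¹) k))
        (fun a a' => B₀' * g.len a * Real.exp (-(δ₀ * g.dist a a'))) := by
      intro k
      rw [mul_assoc]
      refine hasMajorant_pointProbe_mul (G := toB6 g Rr H) (fun p : S × ι => blk p.1) p₀ _ _ _
        (fun a a' => mul_nonneg (mul_nonneg hB₀'0 (hlen a).le) (hE₀ a a')) fun z ν C hν => ?_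
      rw [coordProbe_apply]
      calc |b.repr (Φ ((coordEquiv b).symm ((Gp * conj b (diffLetter T U ((g.eta : ℂ)⁻¹) k)) ν))) i|
          ≤ M₂ * ‖Φ ((coordEquiv b).symm ((Gp * conj b (diffLetter T U ((g.eta : ℂ)⁻¹) k)) ν))‖ := hrepr _ _
        _ ≤ M₂ * (Bh * g.len (blk p₀.1) ^ (1 - β) * cζ * Real.exp (-(δ₀ * g.dist (blk p₀.1) z)) * C) :=
            mul_le_mul_of_nonneg_left (hR k z ν C hν) hM₂
        _ = B₀' * g.len (blk p₀.1) * Real.exp (-(δ₀ * g.dist (blk p₀.1) z)) * C := by rw [hB1]; ring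
    -- (c) ⇒ `X·G′D ≺ B₀′Lʲη e^{−δ₀d}`, rate weakened to `9δ₀/10`
    have hXD : HasMajorant (g := toB6 g Rr H) (fun p : S × ι => blk p.1) (X * (Gp * D))
        (fun a a' => B₀' * g.len a * Real.exp (-(9 / 10 * δ₀ * g.dist a a'))) := by
      refine hasMajorant_rate_mono (R := Rr) (H := H) (r := δ₀) (fun p : S × ι => blk p.1) B₀' (fun a => g.len a) hB₀'0 (fun a => (hlen a).le)
        (by linarith only [hδ₀]) hdnn ?_
      refine hasMajorant_pointProbe_mul (G := toB6 g Rr H) (fun p : S × ι => blk p.1) p₀ _ _ _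
        (fun a a' => mul_nonneg (mul_nonneg hB₀'0 (hlen a).le) (hE₀ a a')) fun z ν C hν => ?_
      rw [coordProbe_apply]
      calc |b.repr (Φ ((coordEquiv b).symm ((Gp * D) ν))) i| ≤ M₂ * ‖Φ ((coordEquiv b).symm ((Gp * D) ν))‖ := hrepr _ _
        _ ≤ M₂ * (Bh * g.len (blk p₀.1) ^ (1 - β) * cζ * Real.exp (-(δ₀ * g.dist (blk p₀.1) z)) * C) :=
            mul_le_mul_of_nonneg_left (hD z ν C hν) hM₂
        _ = B₀' * g.len (blk p₀.1) * Real.exp (-(δ₀ * g.dist (blk p₀.1) z)) * C := by rw [hB1]; ring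
    -- gen 9's LEFT COMPOSITE for the operator `X·G′(U)`: `(X·G′)·V′ ≺ θ_L(B₀′)e^{−(49δ₀/50)d}`
    have hsmall : ∀ z : g.Site, g.eta * (α₁ * (g.len z)⁻¹) ≤ 1 / 4 := fun z => by
      have hq : g.eta * (g.len z)⁻¹ ≤ 1 := by
        rw [← div_eq_mul_inv]; exact (div_le_one (hlen z)).mpr (hlenη z)
      calc g.eta * (α₁ * (g.len z)⁻¹) = α₁ * (g.eta * (g.len z)⁻¹) := by ring
        _ ≤ α₁ * 1 := mul_le_mul_of_nonneg_left hq hα₁0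
        _ ≤ 1 / 4 := by linarith only [hα₁q]
    have hA' : ∀ m x, ‖A m x‖ ≤ α₁ * (g.len (blk x))⁻¹ ∧ ‖tauB T U m (A m) x‖ ≤ α₁ * (g.len (blk x))⁻¹ :=
      fun m x => ⟨hA m x, hAτB m m x⟩
    have h337s' : ∀ m x, ‖((g.eta : ℂ)⁻¹) • covDstar T U m (A m) x‖ ≤ α₁ * (g.len (blk x) ^ 2)⁻¹ := fun m x => h337B m m x
    have h337F' : ∀ m x, ‖((g.eta : ℂ)⁻¹) • covD T U m (A m) x‖ ≤ α₁ * (g.len (blk x) ^ 2)⁻¹ := fun m x => h337F m m x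
    have hd₀' : ∀ m x, g.dist (blk x) (blk (T m x)) ≤ d₀ ∧ g.dist (blk x) (blk ((T m).symm x)) ≤ d₀ :=
      fun m x => ⟨hd₀F m x, hd₀B m x⟩
    have hrc1 : 49 / 50 * δ₀ + (1 / 100 + 1 / 100) * δ₀ ≤ δ₀ := by linarith only [hδ₀]
    have hXV := hasMajorant_gp_vPrime (Rr := Rr) (H := H) b T U blk d hη A kQ kF sQ sF cfun w 1 d₀ M₂ Cq a₀ δ₀ δ₀ (1 / 100) (1 / 100)
      (49 / 50 * δ₀) Λ B₀' α₁ hB₀'0 hα₁0 hΛ0 (by linarith only [hδ₀]) (by norm_num) (by norm_num) hδ₀.le hδ₀.le hrc1 hdnn htri hlen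
      h261β hT1i hT2i hM₂ hrepr hsmall hA' h337s' h337F' h337Bτ hU1 hd₀' hd₀0 hw hcard hCq ha₀ hkQ hkF hsQ hsF hcfun hX1 hX3
    rw [thetaL363_linear] at hXV
    -- `θ_L(1) ≦ K` below the threshold
    have hθK : thetaL363 (Fintype.card κ) 1 α₁ a₀ Cq M₂ (∑ i, ‖b i‖) (Real.exp (δ₀ * d₀)) 1 Λ (B6.c1 d δ₀ (1 / 100)) ≤ K := hKb α₁ hα₁ε
    have hθ0 : 0 ≤ thetaL363 (Fintype.card κ) 1 α₁ a₀ Cq M₂ (∑ i, ‖b i‖) (Real.exp (δ₀ * d₀)) 1 Λ (B6.c1 d δ₀ (1 / 100)) :=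
      thetaL363_nonneg hα₁0 ha₀ hCq hM₂ hSb (Real.exp_nonneg _) zero_le_one hΛ0 (B6RandomWalk.c1_nonneg d δ₀ (1 / 100))
    -- FILE 26's right entry `E·D ≺ B₂₆Lʲη e^{−(9δ₀/10)d}` and the composition [4] (2.52)–(2.55) + Lemma 2.1 at `1/25`
    have hT₂ := hGpR D hGpD
    have hr' : 9 / 10 * δ₀ + (1 / 25 + 1 / 25) * δ₀ ≤ 49 / 50 * δ₀ := by linarith only [hδ₀]
    have hcomp := hasMajorant_comp_decay_left1 (R := Rr) (H := H) (fun p : S × ι => blk p.1) d δ₀ (1 / 25) (1 / 25) (9 / 10 * δ₀) (49 / 50 * δ₀) Λ'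
      (B₀' * thetaL363 (Fintype.card κ) 1 α₁ a₀ Cq M₂ (∑ i, ‖b i‖) (Real.exp (δ₀ * d₀)) 1 Λ (B6.c1 d δ₀ (1 / 100))) B'
      (fun a => g.len a) (fun a => (hlen a).le) hΛ'0 (mul_nonneg hB₀'0 hθ0) hB' (by linarith only [hδ₀]) hr' hdnn htri hT1' h261'
      hXV hT₂
    -- sum of the two pieces: `X·(E·D) = X·(G′D) + (X·G′·V′)·(E·D)`
    have hsplit : X * (E * D) = X * (Gp * D) + X * Gp * V * (E * D) := by
      conv_lhs => rw [hED]
      rw [mul_add]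
      simp only [mul_assoc]
    have hsum := hasMajorant_add (g := toB6 g Rr H) (fun p : S × ι => blk p.1) hXD hcomp
    rw [← hsplit] at hsum
    have hfin : HasMajorant (g := toB6 g Rr H) (fun p : S × ι => blk p.1) (X * (E * D))
        (fun a a' => (B₀' * (1 + K * B' * Λ' * B6.c1 d δ₀ (1 / 25))) * g.len a * Real.exp (-(9 / 10 * δ₀ * g.dist a a'))) := by
      refine hasMajorant_mono (g := toB6 g Rr H) _ hsum fun a a' => ?_
      have hw' : 0 ≤ g.len a * Real.exp (-(9 / 10 * δ₀ * g.dist a a')) := mul_nonneg (hlen a).le (Real.exp_nonneg _)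
      have hθle : B₀' * thetaL363 (Fintype.card κ) 1 α₁ a₀ Cq M₂ (∑ i, ‖b i‖) (Real.exp (δ₀ * d₀)) 1 Λ (B6.c1 d δ₀ (1 / 100)) * B' * Λ' *
          B6.c1 d δ₀ (1 / 25) ≤ B₀' * K * B' * Λ' * B6.c1 d δ₀ (1 / 25) :=
        mul_le_mul_of_nonneg_right (mul_le_mul_of_nonneg_right (mul_le_mul_of_nonneg_right
          (mul_le_mul_of_nonneg_left hθK hB₀'0) hB') hΛ'0) hc1'
      calc B₀' * g.len a * Real.exp (-(9 / 10 * δ₀ * g.dist a a')) +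
            B₀' * thetaL363 (Fintype.card κ) 1 α₁ a₀ Cq M₂ (∑ i, ‖b i‖) (Real.exp (δ₀ * d₀)) 1 Λ (B6.c1 d δ₀ (1 / 100)) * B' * Λ' *
              B6.c1 d δ₀ (1 / 25) * g.len a * Real.exp (-(9 / 10 * δ₀ * g.dist a a'))
          = (B₀' + B₀' * thetaL363 (Fintype.card κ) 1 α₁ a₀ Cq M₂ (∑ i, ‖b i‖) (Real.exp (δ₀ * d₀)) 1 Λ (B6.c1 d δ₀ (1 / 100)) * B' * Λ' *
              B6.c1 d δ₀ (1 / 25)) * (g.len a * Real.exp (-(9 / 10 * δ₀ * g.dist a a'))) := by ring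
        _ ≤ (B₀' + B₀' * K * B' * Λ' * B6.c1 d δ₀ (1 / 25)) * (g.len a * Real.exp (-(9 / 10 * δ₀ * g.dist a a'))) :=
            mul_le_mul_of_nonneg_right (add_le_add le_rfl hθle) hw'
        _ = (B₀' * (1 + K * B' * Λ' * B6.c1 d δ₀ (1 / 25))) * g.len a * Real.exp (-(9 / 10 * δ₀ * g.dist a a')) := by ring
    have hread := probe_le_of_hasMajorant_pointProbe_mul (G := toB6 g Rr H) (fun p : S × ι => blk p.1) p₀
      ((b.coord i) ∘ₗ Φ ∘ₗ (coordEquiv (S := S) b).symm.toLinearMap) (E * D) _ hfin y' μ M hμ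
    simpa only [coordProbe_apply] using hread
  -- from the coordinates to the norm
  have hn := norm_le_sum_norm_mul_of_repr_le b (Φ ((coordEquiv b).symm ((E * D) μ))) _ (fun i => by
    simpa only [coordProbe_apply] using hcoord i)
  calc ‖Φ ((coordEquiv b).symm ((E * D) μ))‖
      ≤ (∑ i, ‖b i‖) * ((B₀' * (1 + K * B' * Λ' * B6.c1 d δ₀ (1 / 25))) * g.len (blk p₀.1) *
          Real.exp (-(9 / 10 * δ₀ * g.dist (blk p₀.1) y')) * M) := hn
    _ = (∑ i, ‖b i‖) * M₂ * (1 + K * B' * Λ' * B6.c1 d δ₀ (1 / 25)) * Bh * g.len (blk p₀.1) ^ (1 - β) * cζ *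
          Real.exp (-(9 / 10 * δ₀ * g.dist (blk p₀.1) y')) * M := by
        have e : (∑ i, ‖b i‖) * ((B₀' * (1 + K * B' * Λ' * B6.c1 d δ₀ (1 / 25))) * g.len (blk p₀.1) *
            Real.exp (-(9 / 10 * δ₀ * g.dist (blk p₀.1) y')) * M) =
            (∑ i, ‖b i‖) * (1 + K * B' * Λ' * B6.c1 d δ₀ (1 / 25)) * (B₀' * g.len (blk p₀.1)) *
            Real.exp (-(9 / 10 * δ₀ * g.dist (blk p₀.1) y')) * M := by ring
        rw [e, hB1]; ring

end GpRight

end Literature.MathematicalPhysics.QuantumFieldTheory.Balaban1983to89.B9Thm34HolderLeftFinal
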